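import Mathlib.MeasureTheory.Group.Prod
import Mathlib.MeasureTheory.Integral.Prod
import Literature.NumberTheory.Automorphic.TateLocalSchwartzBruhat
import Literature.NumberTheory.Automorphic.TateLocalFactorsEpsilonProofs
import Literature.NumberTheory.Automorphic.RankinSelbergLocalUniqueness
import HarnessLib

/-!
# Tate's local functional equation: existence of `γ(s, χ, ψ)` and `ε(s, χ, ψ)` (proved)

Discharge of the named facts `existsUnique_hasTateEpsilon`, `existsUnique_hasTateGamma`,
`hasTateEpsilon_ne_zero`, `hasTateEpsilon_exponent` and `hasTateEpsilon_unramified` of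
`TateLocalFactors` (Tate 1950, Thm. 2.4.1 and §2.5;
Bushnell–Henniart 2006, §23.4–23.5): for a non-archimedean local field `F`, a non-trivial
continuous additive character `ψ`, Haar measures `μ` on `F` and `μ'` on `Fˣ` and a quasi-character
`χ` of exponent `σ`, there is a unique pair `(e, a) ∈ ℂ × ℤ` (and `e ≠ 0`) such that for every
Schwartz–Bruhat `f` and every `s` with `-σ < re s < 1 - σ`,
`Z(f̂, χ⁻¹, 1 - s) = e q^{-as} · L(1 - s, χ⁻¹) / L(s, χ) · Z(f, χ, s)`.

We follow Tate's proof (Tate 1950, §2.4–2.5), in the conventions of `TateLocalFactors`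
(`γ = 1/ρ`, `T = q^{-s}`):

* **Lemma 2.4.2** (`tateZeta_mul_tateZeta_fourierSB_comm`):
  `Z(f, χ, s) Z(ĝ, χ⁻¹, 1-s) = Z(f̂, χ⁻¹, 1-s) Z(g, χ, s)` for `f, g ∈ 𝒮(F)` and `s` in the strip.
  As in Tate, the product is a double integral over `Fˣ × Fˣ`, the shear `(x, y) ↦ (x, xy)`
  preserves `μ' × μ'`, and by Fubini it remains to see that `∫ f(x) ĝ(xy) |x| d^×x` is symmetric
  in `f, g`.  Tate shows this using `d^×x = c · dx/|x|` (his Lemma 2.3.2); we instead substitute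
  `z = x⁻¹t` in `ĝ` (Lemma 2.2.5, `modulus_eq_normAbs`), which cancels `|x|` and exhibits the
  integral as `∫_F ψ(ty) (f ⋆ g)(t) dt` with the multiplicative convolution
  `(f ⋆ g)(t) = ∫ f(x) g(x⁻¹t) d^×x`, symmetric under `x ↦ t x⁻¹` (Haar measures on the abelian
  group `Fˣ` are inversion invariant).
* **Theorem 2.4.1 from one test function per class** (`hasTateGamma_of_test`): if
  `Z(g, χ, s) ≠ 0` and `Z(ĝ, χ⁻¹, 1-s) = γ(q^{-s}) Z(g, χ, s)` on the strip, then `HasTateGamma`.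
* **§2.5, unramified `χ`**: `g = 1_{𝔭^m}` (`m` the conductor exponent of `ψ`), `ĝ = μ(𝔭^m) 1_𝒪`,
  `Z(1_{𝔭^k}, χ, s) = μ'(𝒪ˣ) (χ(ϖ)T)^k / (1 - χ(ϖ)T)` (the geometric series over the shells
  `A_ν`), whence `ε(s, χ, ψ) = μ(𝔭^m) χ(ϖ)^{-m} T^{-m}`.
* **§2.5, ramified `χ`** of conductor exponent `c ≥ 1`: `g = 1_{1+𝔭^c}`, `Z(g, χ, s) = μ'(U^c)`,
  `ĝ = μ(𝔭^c) ψ 1_{𝔭^{m-c}}`, and `Z(ĝ, χ⁻¹, 1-s) = μ(𝔭^c) (q^{-(1-s)})^{m-c} G` with the Gauss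
  sum `G = ∫_{A_{m-c}} ψ χ⁻¹ d^×x`, all other shells vanishing by Tate's averaging argument
  (§2.5, "cases 1 and 2"); whence `ε(s, χ, ψ) = e T^{c-m}`.  That `e ≠ 0` (i.e. `G ≠ 0`) follows
  as in Tate's Lemma 2.4.3 (1) from the functional equation for `χ⁻¹` applied to `ĝ`, whose
  transform `(ĝ)^ = μ(𝔭^c) μ(𝔭^{m-c}) 1_{-1+𝔭^c}` has `Z((ĝ)^, χ, s) = χ(-1) μ(𝔭^c) μ(𝔭^{m-c}) μ'(U^c) ≠ 0`.
* **Uniqueness** of `(e, a)`: `γ` is unique (`HasTateGamma.unique`, `TateLocalFactorsProofs`),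
  `γ ≠ 0`, and `e T^a` determines `(e, a)` for `e ≠ 0` (`tateEpsilonRat_injective`).

Everything is PROVED (theorems only; no definition, no named fact, no instance).

## Main statements

* `tateZeta_mul_tateZeta_fourierSB_comm` — Tate's Lemma 2.4.2.
* `exists_hasTateEpsilon` — existence of the `ε`-factor with `e ≠ 0`.
* `existsUnique_hasTateEpsilon_holds`, `existsUnique_hasTateGamma_holds`,
  `hasTateEpsilon_ne_zero_holds`, `hasTateEpsilon_exponent_holds` (`a = c - m`),
  `hasTateEpsilon_unramified_holds` (`ε = 1` for `χ` unramified, `ψ` of level `0`, `μ(𝒪) = 1`) —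
  discharges of the five named facts of the `Zeta` section of `TateLocalFactors`.

## References

* J. Tate, *Fourier analysis in number fields and Hecke's zeta-functions* (1950), in
  Cassels–Fröhlich, *Algebraic Number Theory* (1967), Ch. XV, §2.2 (Lemma 2.2.5), §2.4
  (Lemma 2.4.2, Thm. 2.4.1, Lemma 2.4.3), §2.5 (`k` `𝔭`-adic). [Tate1950] [CasselsFrohlichANT1967]
* C. J. Bushnell, G. Henniart, *The local Langlands conjecture for GL(2)* (2006), §23.4–23.5.
  [BushnellHenniart2006]
-/

set_option autoImplicit false

noncomputable section

open scoped NNReal ENNReal Topology Pointwise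
open MeasureTheory ValuativeRel Filter Set Function Polynomial
  Literature.NumberTheory.GaloisRepresentations.IsNonarchimedeanLocalField

namespace Literature.NumberTheory.Automorphic

/-! ### Evaluating rational functions of `T = q^{-s}` -/

section RatFuncEval

/-- **Pole-free evaluation of a quotient of polynomials**: if `D(t) ≠ 0` then Mathlib's
`RatFunc.eval` of `N/D` at `t` is `N(t)/D(t)` (the reduced numerator and denominator differ from
`N, D` by the common factor `gcd N D`, which does not vanish at `t`). [folklore] -/
theorem ratFunc_eval_div_of_eval_ne_zero (N D : ℂ[X]) {t : ℂ} (hD : D.eval t ≠ 0) :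
    (algebraMap ℂ[X] (RatFunc ℂ) N / algebraMap ℂ[X] (RatFunc ℂ) D).eval (RingHom.id ℂ) t =
      N.eval t / D.eval t := by
  classical
  have hD0 : D ≠ 0 := by
    rintro rfl
    simp at hD
  set g : ℂ[X] := gcd N D with hg
  obtain ⟨N', hN'⟩ : g ∣ N := gcd_dvd_left N D
  obtain ⟨D', hD'⟩ : g ∣ D := gcd_dvd_right N D
  have hg0 : g ≠ 0 := fun h => hD0 (by rw [hD', h, zero_mul])
  have hNg : N / g = N' := by rw [hN', mul_comm, mul_div_cancel_right₀ _ hg0]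
  have hDg : D / g = D' := by rw [hD', mul_comm, mul_div_cancel_right₀ _ hg0]
  have hevD : D.eval t = g.eval t * D'.eval t := by rw [hD', eval_mul]
  have hg_t : g.eval t ≠ 0 := fun h => hD (by rw [hevD, h, zero_mul])
  have hD'_t : D'.eval t ≠ 0 := fun h => hD (by rw [hevD, h, mul_zero])
  have hlc : D'.leadingCoeff⁻¹ ≠ 0 :=
    inv_ne_zero (leadingCoeff_ne_zero.2 fun h => hD'_t (by rw [h, eval_zero]))
  rw [RatFunc.eval, RatFunc.num_div, RatFunc.denom_div N hD0, hNg, hDg]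
  simp only [eval₂_mul, eval₂_C, RingHom.id_apply, Polynomial.eval₂_id]
  rw [mul_div_mul_left _ _ hlc, hN', hD', eval_mul, eval_mul, mul_div_mul_left _ _ hg_t]

/-- `R(q^{-s})` for `R = N/D` with `D(q^{-s}) ≠ 0`. [folklore] -/
theorem evalAtQ_div_of_eval_ne_zero (q : ℕ) (N D : ℂ[X]) {s : ℂ}
    (hD : D.eval ((q : ℂ) ^ (-s)) ≠ 0) :
    evalAtQ q (algebraMap ℂ[X] (RatFunc ℂ) N / algebraMap ℂ[X] (RatFunc ℂ) D) s =
      N.eval ((q : ℂ) ^ (-s)) / D.eval ((q : ℂ) ^ (-s)) :=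
  ratFunc_eval_div_of_eval_ne_zero N D hD

/-- `T^a = T^{a⁺} / T^{a⁻}` in `ℂ(T)` (`a ∈ ℤ`). [folklore] -/
theorem ratFunc_X_zpow_eq_div (a : ℤ) :
    (RatFunc.X : RatFunc ℂ) ^ a =
      algebraMap ℂ[X] (RatFunc ℂ) (X ^ a.toNat) / algebraMap ℂ[X] (RatFunc ℂ) (X ^ (-a).toNat) := by
  have h := Int.toNat_sub_toNat_neg a
  rw [map_pow, map_pow, RatFunc.algebraMap_X, eq_div_iff (pow_ne_zero _ RatFunc.X_ne_zero),
    ← zpow_natCast, ← zpow_natCast, ← zpow_add₀ RatFunc.X_ne_zero]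
  congr 1
  omega

/-- **`(e T^a)(q^{-s}) = e (q^{-s})^a`** for the `ε`-monomial (no poles off `T = 0`). [folklore] -/
theorem evalAtQ_tateEpsilonRat {q : ℕ} (hq : q ≠ 0) (e : ℂ) (a : ℤ) (s : ℂ) :
    evalAtQ q (tateEpsilonRat e a) s = e * ((q : ℂ) ^ (-s)) ^ a := by
  have hT : (q : ℂ) ^ (-s) ≠ 0 := (Complex.cpow_ne_zero_iff.2 (Or.inl (Nat.cast_ne_zero.2 hq)))
  have h := Int.toNat_sub_toNat_neg a
  rw [tateEpsilonRat, ratFunc_X_zpow_eq_div, mul_div_assoc', ← RatFunc.algebraMap_C, ← map_mul,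
    evalAtQ_div_of_eval_ne_zero q _ _ (by rw [eval_pow, eval_X]; exact pow_ne_zero _ hT),
    eval_mul, eval_C, eval_pow, eval_X, eval_pow, eval_X, mul_div_assoc, ← zpow_natCast,
    ← zpow_natCast, ← zpow_sub₀ hT]
  congr 2

end RatFuncEval

variable {F : Type*} [Field F] [ValuativeRel F] [TopologicalSpace F] [IsNonarchimedeanLocalField F]

/-! ### Exponents of `χ⁻¹` and of the trivial character -/

section Exponent

/-- `χ⁻¹` has exponent `-σ`. [folklore] -/
theorem QuasiChar.HasExponent.inv {χ : QuasiChar F} {σ : ℝ} (hσ : χ.HasExponent σ) :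
    (χ⁻¹).HasExponent (-σ) := by
  intro x
  change ‖(((χ x)⁻¹ : ℂˣ) : ℂ)‖ = _
  rw [Units.val_inv_eq_inv_val, norm_inv, hσ x, Real.rpow_neg (NNReal.coe_nonneg _)]

/-- The trivial quasi-character has exponent `0`. [folklore] -/
theorem QuasiChar.hasExponent_one : (1 : QuasiChar F).HasExponent 0 := by
  intro x
  change ‖((1 : ℂˣ) : ℂ)‖ = _
  rw [Units.val_one, norm_one, Real.rpow_zero]

end Exponent

/-! ### Tate's Lemma 2.4.2 -/

section FubiniTrick

variable [MeasurableSpace F] [BorelSpace F]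

/-- `x ↦ f(x) |x|` is integrable on `Fˣ` for `f ∈ 𝒮(F)` (the zeta integrand of the trivial
character at `s = 1`). [folklore] -/
theorem integrable_mul_normAbs (μ' : Measure Fˣ) [IsFiniteMeasureOnCompacts μ']
    [μ'.IsMulLeftInvariant] {f : F → ℂ} (hf : f ∈ SchwartzBruhat F) :
    Integrable (fun x : Fˣ => f (x : F) * (((normAbs F (x : F) : ℝ≥0) : ℝ) : ℂ)) μ' := by
  have h := integrable_tateZetaIntegrand μ' hf QuasiChar.hasExponent_one (s := 1)
    (by rw [Complex.one_re]; norm_num)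
  refine h.congr (ae_of_all _ fun x => ?_)
  change f (x : F) * ((1 : ℂˣ) : ℂ) * _ = _
  rw [Units.val_one, mul_one, Complex.cpow_one]

/-- **The shear step of Tate's Lemma 2.4.2**: for `f, g ∈ 𝒮(F)`, `χ` of exponent `σ` and
`-σ < re s < 1 - σ`,
`Z(f, χ, s) · Z(ĝ, χ⁻¹, 1-s) = ∫ (∫ f(x) ĝ(xy) |x| d^×x) χ⁻¹(y) |y|^{1-s} d^×y`
("subjecting `k^* × k^*` to the shearing automorphism `(α, β) → (α, αβ)` … according to Fubini";
Tate 1950, §2.4, proof of Lemma 2.4.2). [cite: Tate1950, §2.4, Lemma 2.4.2] -/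
theorem tateZeta_mul_tateZeta_fourierSB_eq_integral (μ : Measure F) [μ.IsAddHaarMeasure]
    (μ' : Measure Fˣ) [μ'.IsHaarMeasure] {ψ : AddChar F Circle} (hψ : ψ.IsContinuousNontrivial)
    {χ : QuasiChar F} {σ : ℝ} (hσ : χ.HasExponent σ) {f g : F → ℂ} (hf : f ∈ SchwartzBruhat F)
    (hg : g ∈ SchwartzBruhat F) {s : ℂ} (hs1 : -σ < s.re) (hs2 : s.re < 1 - σ) :
    tateZeta μ' f χ s * tateZeta μ' (fourierSB ψ μ g) χ⁻¹ (1 - s) =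
      ∫ y : Fˣ, (∫ x : Fˣ, f (x : F) * fourierSB ψ μ g ((x : F) * y) *
          (((normAbs F (x : F) : ℝ≥0) : ℝ) : ℂ) ∂μ') *
        (((χ⁻¹ y : ℂˣ) : ℂ) * (((normAbs F (y : F) : ℝ≥0) : ℝ) : ℂ) ^ (1 - s)) ∂μ' := by
  haveI : BorelSpace Fˣ := Units.borelSpace
  haveI : T2Space F := (GaloisRepresentations.IsNonarchimedeanLocalField.isLocalField F).toT2Space
  haveI := secondCountableTopology_units F
  haveI := sigmaCompactSpace_units F
  set A : Fˣ → ℂ := fun x =>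
    f (x : F) * ((χ x : ℂˣ) : ℂ) * (((normAbs F (x : F) : ℝ≥0) : ℝ) : ℂ) ^ s with hA
  set B : Fˣ → ℂ := fun y => fourierSB ψ μ g (y : F) * ((χ⁻¹ y : ℂˣ) : ℂ) *
    (((normAbs F (y : F) : ℝ≥0) : ℝ) : ℂ) ^ (1 - s) with hB
  have hAi : Integrable A μ' := integrable_tateZetaIntegrand μ' hf hσ hs1
  have hBi : Integrable B μ' :=
    integrable_tateZetaIntegrand μ' (fourierSB_mem_schwartzBruhat μ hψ hg) hσ.inv
      (by rw [Complex.sub_re, Complex.one_re]; linarith)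
  -- the product of the two zeta integrals as a double integral, then the shear
  have h1 : tateZeta μ' f χ s * tateZeta μ' (fourierSB ψ μ g) χ⁻¹ (1 - s) =
      ∫ z : Fˣ × Fˣ, A z.1 * B z.2 ∂(μ'.prod μ') := by
    rw [integral_prod_mul]
    rfl
  have hT : MeasurePreserving (MeasurableEquiv.shearMulRight Fˣ) (μ'.prod μ') (μ'.prod μ') :=
    measurePreserving_prod_mul μ' μ'
  have h2 : ∫ z : Fˣ × Fˣ, A z.1 * B (z.1 * z.2) ∂(μ'.prod μ') =
      ∫ z : Fˣ × Fˣ, A z.1 * B z.2 ∂(μ'.prod μ') :=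
    hT.integral_comp' (f := MeasurableEquiv.shearMulRight Fˣ) (fun z => A z.1 * B z.2)
  have hHi : Integrable (fun z : Fˣ × Fˣ => A z.1 * B (z.1 * z.2)) (μ'.prod μ') :=
    (hT.integrable_comp_emb (MeasurableEquiv.shearMulRight Fˣ).measurableEmbedding).2
      (hAi.mul_prod hBi)
  -- pointwise algebra on the sheared integrand
  have h3 : ∀ x y : Fˣ, A x * B (x * y) =
      f (x : F) * fourierSB ψ μ g ((x : F) * y) * (((normAbs F (x : F) : ℝ≥0) : ℝ) : ℂ) *
        (((χ⁻¹ y : ℂˣ) : ℂ) * (((normAbs F (y : F) : ℝ≥0) : ℝ) : ℂ) ^ (1 - s)) := by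
    intro x y
    have hx0 : (((normAbs F (x : F) : ℝ≥0) : ℝ) : ℂ) ≠ 0 := by
      exact_mod_cast normAbs_units_ne_zero x
    have hχ0 : ((χ x : ℂˣ) : ℂ) ≠ 0 := (χ x).ne_zero
    have hχ : ((χ⁻¹ (x * y) : ℂˣ) : ℂ) = ((χ x : ℂˣ) : ℂ)⁻¹ * ((χ⁻¹ y : ℂˣ) : ℂ) := by
      change (((χ (x * y))⁻¹ : ℂˣ) : ℂ) = ((χ x : ℂˣ) : ℂ)⁻¹ * (((χ y)⁻¹ : ℂˣ) : ℂ)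
      rw [map_mul, mul_inv, Units.val_mul, Units.val_inv_eq_inv_val, Units.val_inv_eq_inv_val]
    have hn : (((normAbs F ((x * y : Fˣ) : F) : ℝ≥0) : ℝ) : ℂ) ^ (1 - s) =
        (((normAbs F (x : F) : ℝ≥0) : ℝ) : ℂ) ^ (1 - s) *
          (((normAbs F (y : F) : ℝ≥0) : ℝ) : ℂ) ^ (1 - s) := by
      rw [Units.val_mul, map_mul, NNReal.coe_mul, Complex.ofReal_mul,
        Complex.mul_cpow_ofReal_nonneg (NNReal.coe_nonneg _) (NNReal.coe_nonneg _)]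
    have hpow : (((normAbs F (x : F) : ℝ≥0) : ℝ) : ℂ) ^ s *
        (((normAbs F (x : F) : ℝ≥0) : ℝ) : ℂ) ^ (1 - s) = (((normAbs F (x : F) : ℝ≥0) : ℝ) : ℂ) := by
      rw [← Complex.cpow_add _ _ hx0, add_sub_cancel, Complex.cpow_one]
    simp only [hA, hB]
    rw [hχ, hn, Units.val_mul]
    calc f (x : F) * ((χ x : ℂˣ) : ℂ) * (((normAbs F (x : F) : ℝ≥0) : ℝ) : ℂ) ^ s *
          (fourierSB ψ μ g ((x : F) * y) * (((χ x : ℂˣ) : ℂ)⁻¹ * ((χ⁻¹ y : ℂˣ) : ℂ)) *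
            ((((normAbs F (x : F) : ℝ≥0) : ℝ) : ℂ) ^ (1 - s) *
              (((normAbs F (y : F) : ℝ≥0) : ℝ) : ℂ) ^ (1 - s)))
        = f (x : F) * fourierSB ψ μ g ((x : F) * y) *
            ((((normAbs F (x : F) : ℝ≥0) : ℝ) : ℂ) ^ s *
              (((normAbs F (x : F) : ℝ≥0) : ℝ) : ℂ) ^ (1 - s)) *
            (((χ⁻¹ y : ℂˣ) : ℂ) * (((normAbs F (y : F) : ℝ≥0) : ℝ) : ℂ) ^ (1 - s)) *
            (((χ x : ℂˣ) : ℂ) * ((χ x : ℂˣ) : ℂ)⁻¹) := by ring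
      _ = _ := by rw [hpow, mul_inv_cancel₀ hχ0, mul_one]
  -- Fubini, integrating over `x` first
  rw [h1, ← h2, integral_prod_symm _ hHi]
  refine integral_congr_ae (ae_of_all _ fun y => ?_)
  dsimp only
  rw [← integral_mul_const]
  exact integral_congr_ae (ae_of_all _ fun x => h3 x y)

/-- **The dilation step**: `f(x) ĝ(xy) |x| = ∫_F ψ(ty) f(x) g(x⁻¹t) dt`, by the
substitution `z = x⁻¹t`, `dz = |x|⁻¹ dt` in `ĝ(xy) = ∫ ψ(zxy) g(z) dz` (Tate 1950, Lemma 2.2.5).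
[cite: Tate1950, §2.2, Lemma 2.2.5] -/
theorem mul_fourierSB_mul_normAbs_eq_integral (μ : Measure F) [μ.IsAddHaarMeasure]
    (ψ : AddChar F Circle) (f g : F → ℂ) (x y : Fˣ) :
    f (x : F) * fourierSB ψ μ g ((x : F) * y) * (((normAbs F (x : F) : ℝ≥0) : ℝ) : ℂ) =
      ∫ t : F, ((ψ (t * y) : Circle) : ℂ) * (f (x : F) * g ((x : F)⁻¹ * t)) ∂μ := by
  have hX0 : (((normAbs F (x : F) : ℝ≥0) : ℝ) : ℂ) ≠ 0 := by exact_mod_cast normAbs_units_ne_zero x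
  have hJ : ∫ z : F, ((ψ (z * ((x : F) * y)) : Circle) : ℂ) * g z ∂μ =
      (((normAbs F (x : F) : ℝ≥0) : ℝ) : ℂ)⁻¹ *
        ∫ t : F, ((ψ (t * y) : Circle) : ℂ) * g ((x : F)⁻¹ * t) ∂μ := by
    have h := integral_comp_mul_left μ (inv_ne_zero x.ne_zero)
      (fun z => ((ψ (z * ((x : F) * y)) : Circle) : ℂ) * g z)
    have harg : ∀ t : F, (x : F)⁻¹ * t * ((x : F) * y) = t * y := fun t => by
      field_simp
    simp only [harg, inv_inv, Complex.real_smul] at h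
    rw [h, ← mul_assoc, inv_mul_cancel₀ hX0, one_mul]
  set J : ℂ := ∫ t : F, ((ψ (t * y) : Circle) : ℂ) * g ((x : F)⁻¹ * t) ∂μ with hJdef
  rw [fourierSB_apply, hJ]
  calc f (x : F) * ((((normAbs F (x : F) : ℝ≥0) : ℝ) : ℂ)⁻¹ * J) *
        (((normAbs F (x : F) : ℝ≥0) : ℝ) : ℂ)
      = f (x : F) * J * ((((normAbs F (x : F) : ℝ≥0) : ℝ) : ℂ)⁻¹ *
          (((normAbs F (x : F) : ℝ≥0) : ℝ) : ℂ)) := by ring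
    _ = f (x : F) * J := by rw [inv_mul_cancel₀ hX0, mul_one]
    _ = ∫ t : F, f (x : F) * (((ψ (t * y) : Circle) : ℂ) * g ((x : F)⁻¹ * t)) ∂μ :=
        (integral_const_mul _ _).symm
    _ = _ := integral_congr_ae (ae_of_all _ fun t => by ring)

/-- **The inner integral of Lemma 2.4.2 as an additive Fourier integral of the multiplicative
convolution**: `∫ f(x) ĝ(xy) |x| d^×x = ∫_F ψ(ty) (∫ f(x) g(x⁻¹t) d^×x) dt` for `f, g ∈ 𝒮(F)`
(Fubini on `Fˣ × F`; Tate 1950, §2.4, proof of Lemma 2.4.2). [cite: Tate1950, §2.4, Lemma 2.4.2] -/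
theorem integral_mul_fourierSB_mul_normAbs_eq (μ : Measure F) [μ.IsAddHaarMeasure]
    (μ' : Measure Fˣ) [μ'.IsHaarMeasure] {ψ : AddChar F Circle} (hψ : ψ.IsContinuousNontrivial)
    {f g : F → ℂ} (hf : f ∈ SchwartzBruhat F) (hg : g ∈ SchwartzBruhat F) (y : Fˣ) :
    ∫ x : Fˣ, f (x : F) * fourierSB ψ μ g ((x : F) * y) * (((normAbs F (x : F) : ℝ≥0) : ℝ) : ℂ) ∂μ' =
      ∫ t : F, ((ψ (t * y) : Circle) : ℂ) * ∫ x : Fˣ, f (x : F) * g ((x : F)⁻¹ * t) ∂μ' ∂μ := by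
  haveI : BorelSpace Fˣ := Units.borelSpace
  haveI : T2Space F := (GaloisRepresentations.IsNonarchimedeanLocalField.isLocalField F).toT2Space
  haveI := secondCountableTopology_localField F
  haveI := secondCountableTopology_units F
  haveI := sigmaCompactSpace_units F
  haveI := sigmaCompactSpace_of_isNonarchimedeanLocalField F
  have hfc := continuous_of_mem_schwartzBruhat hf
  have hgc := continuous_of_mem_schwartzBruhat hg
  set K : Fˣ → F → ℂ := fun x t => ((ψ (t * y) : Circle) : ℂ) * (f (x : F) * g ((x : F)⁻¹ * t))
    with hKdef
  have hcont : Continuous (Function.uncurry K) := by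
    refine Continuous.mul ?_ ?_
    · exact continuous_subtype_val.comp (hψ.1.comp (continuous_snd.mul continuous_const))
    · exact (hfc.comp (Units.continuous_val.comp continuous_fst)).mul
        (hgc.comp (((Units.continuous_val.comp continuous_fst).inv₀ fun z => z.1.ne_zero).mul
          continuous_snd))
  have hK : Integrable (Function.uncurry K) (μ'.prod μ) := by
    refine (integrable_prod_iff hcont.aestronglyMeasurable).2 ⟨ae_of_all _ fun x => ?_, ?_⟩
    · have hgi : Integrable (fun t => g ((x : F)⁻¹ * t)) μ :=
        (integrable_comp_mul_left_iff μ (inv_ne_zero x.ne_zero) g).2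
          (hgc.integrable_of_hasCompactSupport ((mem_schwartzBruhat_iff).1 hg).2)
      refine (hgi.const_mul (f (x : F))).bdd_mul (c := 1) ?_ (ae_of_all _ fun t => ?_)
      · exact (continuous_subtype_val.comp
          (hψ.1.comp (continuous_id.mul continuous_const))).aestronglyMeasurable
      · simp only [Circle.norm_coe, le_refl]
    · have hnorm : ∀ x : Fˣ, ∫ t, ‖Function.uncurry K (x, t)‖ ∂μ =
          ‖f (x : F) * (((normAbs F (x : F) : ℝ≥0) : ℝ) : ℂ)‖ * ∫ t, ‖g t‖ ∂μ := by
        intro x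
        have h := integral_comp_mul_left μ (inv_ne_zero x.ne_zero) fun t => ‖g t‖
        rw [inv_inv] at h
        simp only [Function.uncurry_apply_pair, hKdef, norm_mul, Circle.norm_coe, one_mul]
        rw [integral_const_mul, h, smul_eq_mul, ← mul_assoc, Complex.norm_real, Real.norm_eq_abs,
          abs_of_nonneg (NNReal.coe_nonneg _)]
      exact (((integrable_mul_normAbs μ' hf).norm.mul_const _).congr
        (ae_of_all _ fun x => (hnorm x).symm))
  have h1 : ∀ x : Fˣ, f (x : F) * fourierSB ψ μ g ((x : F) * y) *
      (((normAbs F (x : F) : ℝ≥0) : ℝ) : ℂ) = ∫ t, K x t ∂μ :=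
    fun x => mul_fourierSB_mul_normAbs_eq_integral μ ψ f g x y
  simp_rw [h1]
  rw [integral_integral_swap hK]
  refine integral_congr_ae (ae_of_all _ fun t => ?_)
  exact integral_const_mul _ _

/-- **The multiplicative convolution is symmetric**: `∫ f(x) g(x⁻¹u) d^×x = ∫ g(x) f(x⁻¹u) d^×x`
(`u ∈ Fˣ`), by the substitution `x ↦ u x⁻¹`, which preserves the (inversion invariant) Haar
measure of the abelian group `Fˣ`. [folklore] -/
theorem integral_mul_comp_inv_mul_comm (μ' : Measure Fˣ) [μ'.IsHaarMeasure] (f g : F → ℂ)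
    (u : Fˣ) :
    ∫ x : Fˣ, f (x : F) * g ((x : F)⁻¹ * u) ∂μ' = ∫ x : Fˣ, g (x : F) * f ((x : F)⁻¹ * u) ∂μ' := by
  haveI : BorelSpace Fˣ := Units.borelSpace
  haveI := isInvInvariant_of_isHaarMeasure_units μ'
  have h := (Measure.measurePreserving_div_left μ' u).integral_comp
    (MeasurableEquiv.divLeft u).measurableEmbedding (fun x : Fˣ => g (x : F) * f ((x : F)⁻¹ * u))
  rw [← h]
  refine integral_congr_ae (ae_of_all _ fun x => ?_)
  have e0 : ((u / x : Fˣ) : F) = (u : F) * (x : F)⁻¹ := by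
    rw [div_eq_mul_inv, Units.val_mul, Units.val_inv_eq_inv_val]
  have e1 : ((u : F) * (x : F)⁻¹)⁻¹ * u = x := by field_simp
  dsimp only
  rw [e0, e1, mul_comm ((x : F)⁻¹) (u : F), mul_comm (g _) (f _)]

/-- **The inner integral of Lemma 2.4.2 is symmetric in `f, g`** (Tate 1950, §2.4: "it suffices
to show that the inner integral `∫ f(α) ĝ(αβ) |α| dα` is symmetric in `f` and `g`").
[cite: Tate1950, §2.4, Lemma 2.4.2] -/
theorem integral_mul_fourierSB_mul_normAbs_comm (μ : Measure F) [μ.IsAddHaarMeasure]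
    (μ' : Measure Fˣ) [μ'.IsHaarMeasure] {ψ : AddChar F Circle} (hψ : ψ.IsContinuousNontrivial)
    {f g : F → ℂ} (hf : f ∈ SchwartzBruhat F) (hg : g ∈ SchwartzBruhat F) (y : Fˣ) :
    ∫ x : Fˣ, f (x : F) * fourierSB ψ μ g ((x : F) * y) * (((normAbs F (x : F) : ℝ≥0) : ℝ) : ℂ) ∂μ' =
      ∫ x : Fˣ, g (x : F) * fourierSB ψ μ f ((x : F) * y) *
        (((normAbs F (x : F) : ℝ≥0) : ℝ) : ℂ) ∂μ' := by
  rw [integral_mul_fourierSB_mul_normAbs_eq μ μ' hψ hf hg y,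
    integral_mul_fourierSB_mul_normAbs_eq μ μ' hψ hg hf y]
  have h0 : μ {0} = 0 := by
    haveI := regular_of_isAddHaarMeasure μ
    haveI : T2Space F := (GaloisRepresentations.IsNonarchimedeanLocalField.isLocalField F).toT2Space
    exact GaloisRepresentations.measure_singleton_zero_eq_zero
      (GaloisRepresentations.IsNonarchimedeanLocalField.isLocalField F).not_discrete μ
  have hae : ∀ᵐ t ∂μ, t ≠ 0 := by
    rw [ae_iff]
    simpa using h0
  refine integral_congr_ae ?_
  filter_upwards [hae] with t ht
  have h := integral_mul_comp_inv_mul_comm μ' f g (Units.mk0 t ht)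
  rw [Units.val_mk0] at h
  rw [h]

/-- **Tate's Lemma 2.4.2**: for `f, g ∈ 𝒮(F)`, `χ` of exponent `σ` and `-σ < re s < 1 - σ`,
`Z(f, χ, s) Z(ĝ, χ⁻¹, 1-s) = Z(f̂, χ⁻¹, 1-s) Z(g, χ, s)` (Tate 1950, §2.4, Lemma 2.4.2:
"`ζ(f, c) ζ(ĝ, ĉ) = ζ(f̂, ĉ) ζ(g, c)` for `0 <` exponent `c < 1`"; here `c = χ |·|^s`, and
Haar measures `μ` on `F`, `μ'` on `Fˣ` are arbitrary). [cite: Tate1950, §2.4, Lemma 2.4.2] -/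
theorem tateZeta_mul_tateZeta_fourierSB_comm (μ : Measure F) [μ.IsAddHaarMeasure]
    (μ' : Measure Fˣ) [μ'.IsHaarMeasure] {ψ : AddChar F Circle} (hψ : ψ.IsContinuousNontrivial)
    {χ : QuasiChar F} {σ : ℝ} (hσ : χ.HasExponent σ) {f g : F → ℂ} (hf : f ∈ SchwartzBruhat F)
    (hg : g ∈ SchwartzBruhat F) {s : ℂ} (hs1 : -σ < s.re) (hs2 : s.re < 1 - σ) :
    tateZeta μ' f χ s * tateZeta μ' (fourierSB ψ μ g) χ⁻¹ (1 - s) =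
      tateZeta μ' (fourierSB ψ μ f) χ⁻¹ (1 - s) * tateZeta μ' g χ s := by
  rw [tateZeta_mul_tateZeta_fourierSB_eq_integral μ μ' hψ hσ hf hg hs1 hs2,
    mul_comm (tateZeta μ' (fourierSB ψ μ f) χ⁻¹ (1 - s)),
    tateZeta_mul_tateZeta_fourierSB_eq_integral μ μ' hψ hσ hg hf hs1 hs2]
  refine integral_congr_ae (ae_of_all _ fun y => ?_)
  dsimp only
  rw [integral_mul_fourierSB_mul_normAbs_comm μ μ' hψ hf hg y]

end FubiniTrick


/-! ### Theorem 2.4.1 from one test function -/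

section Test

variable [MeasurableSpace F] [BorelSpace F]

omit [BorelSpace F] in
/-- `Z(a f, χ, s) = a Z(f, χ, s)`. [folklore] -/
theorem tateZeta_const_mul (μ' : Measure Fˣ) (a : ℂ) (f : F → ℂ) (χ : QuasiChar F) (s : ℂ) :
    tateZeta μ' (fun x => a * f x) χ s = a * tateZeta μ' f χ s := by
  rw [tateZeta, tateZeta, ← integral_const_mul]
  refine integral_congr_ae (ae_of_all _ fun x => ?_)
  simp only [mul_assoc]

/-- **Tate's Theorem 2.4.1 from a single test function** (Tate 1950, §2.4, proof of Thm. 2.4.1: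
"`ζ(f, c) ζ(f̂_C, ĉ) = ζ(f̂, ĉ) ζ(f_C, c)`, therefore `ζ(f, c) = ρ(c) ζ(f̂, ĉ)`"): if `g ∈ 𝒮(F)`
has `Z(g, χ, s) ≠ 0` and `Z(ĝ, χ⁻¹, 1-s) = γ(q^{-s}) Z(g, χ, s)` throughout the strip, then the
functional equation `HasTateGamma ψ μ μ' χ γ` holds for every `f ∈ 𝒮(F)` (Lemma 2.4.2 and
cancellation of `Z(g, χ, s)`). [cite: Tate1950, §2.4, Thm. 2.4.1] -/
theorem hasTateGamma_of_test (μ : Measure F) [μ.IsAddHaarMeasure] (μ' : Measure Fˣ)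
    [μ'.IsHaarMeasure] {ψ : AddChar F Circle} (hψ : ψ.IsContinuousNontrivial) {χ : QuasiChar F}
    {γ : RatFunc ℂ} {g : F → ℂ} (hg : g ∈ SchwartzBruhat F)
    (htest : ∀ σ : ℝ, χ.HasExponent σ → ∀ s : ℂ, -σ < s.re → s.re < 1 - σ →
      tateZeta μ' g χ s ≠ 0 ∧ tateZeta μ' (fourierSB ψ μ g) χ⁻¹ (1 - s) =
        evalAtQ (residueFieldCard F) γ s * tateZeta μ' g χ s) :
    HasTateGamma ψ μ μ' χ γ := by
  intro σ hσ f hf s hs1 hs2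
  obtain ⟨hne, hγ⟩ := htest σ hσ s hs1 hs2
  have key := tateZeta_mul_tateZeta_fourierSB_comm μ μ' hψ hσ hf hg hs1 hs2
  have h2 : evalAtQ (residueFieldCard F) γ s * tateZeta μ' f χ s * tateZeta μ' g χ s =
      tateZeta μ' (fourierSB ψ μ f) χ⁻¹ (1 - s) * tateZeta μ' g χ s := by
    rw [← key, hγ]
    ring
  exact (mul_right_cancel₀ hne h2).symm

end Test

/-! ### §2.5, the unramified case -/

section Unramified

/-- `|x|^s = (q^{-s})^k` when `|x| = q^{-k}` (Tate 1950, §2.5: "`|α| = N𝔭^{-ν}`").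
[cite: Tate1950, §2.5] -/
theorem normAbs_cpow_eq_of_eq_zpow {x : F} {k : ℤ}
    (hx : normAbs F x = (residueFieldCard F : ℝ≥0)⁻¹ ^ k) (s : ℂ) :
    (((normAbs F x : ℝ≥0) : ℝ) : ℂ) ^ s = ((residueFieldCard F : ℂ) ^ (-s)) ^ k := by
  have hq0 : (0 : ℝ) < residueFieldCard F := by
    exact_mod_cast Nat.pos_of_ne_zero (residueFieldCard_ne_zero F)
  have hbase : (((normAbs F x : ℝ≥0) : ℝ) : ℂ) = (residueFieldCard F : ℂ) ^ (((-k : ℤ)) : ℂ) := by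
    rw [hx, Complex.cpow_intCast]
    push_cast
    rw [inv_zpow']
  have him : (Complex.log (residueFieldCard F : ℂ) * (((-k : ℤ)) : ℂ)).im = 0 := by
    rw [← Complex.ofReal_natCast, ← Complex.ofReal_log hq0.le, ← Complex.ofReal_intCast,
      ← Complex.ofReal_mul, Complex.ofReal_im]
  rw [hbase, ← Complex.cpow_int_mul, ← Complex.cpow_mul _ (by rw [him]; exact neg_lt_zero.2 Real.pi_pos)
    (by rw [him]; exact Real.pi_pos.le)]
  congr 1
  push_cast
  ring

/-- `‖χ(ϖ) q^{-s}‖ < 1` for `χ` of exponent `σ`, `|ϖ| = q⁻¹` and `re s > -σ` (convergence of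
the geometric series `∑ (χ(ϖ) q^{-s})^ν`, Tate 1950, §2.5). [cite: Tate1950, §2.5] -/
theorem norm_quasiChar_mul_cpow_lt_one {χ : QuasiChar F} {σ : ℝ} (hσ : χ.HasExponent σ)
    {ϖ : F} (hϖ0 : ϖ ≠ 0) (hϖ : normAbs F ϖ = (residueFieldCard F : ℝ≥0)⁻¹) {s : ℂ}
    (hs : -σ < s.re) :
    ‖((χ (Units.mk0 ϖ hϖ0) : ℂˣ) : ℂ) * (residueFieldCard F : ℂ) ^ (-s)‖ < 1 := by
  have hq : (1 : ℝ) < residueFieldCard F := by exact_mod_cast one_lt_residueFieldCard F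
  have hq0 : (0 : ℝ) < residueFieldCard F := zero_lt_one.trans hq
  rw [norm_mul, hσ, Units.val_mk0, hϖ, Complex.norm_natCast_cpow_of_pos (Nat.pos_of_ne_zero
    (residueFieldCard_ne_zero F)), NNReal.coe_inv, NNReal.coe_natCast,
    Real.inv_rpow hq0.le, ← Real.rpow_neg hq0.le, ← Real.rpow_add hq0, Complex.neg_re]
  exact Real.rpow_lt_one_of_one_lt_of_neg hq (by linarith)

/-- `χ⁻¹` is unramified if `χ` is. [folklore] -/
theorem QuasiChar.IsUnramified.inv {χ : QuasiChar F} (hχ : χ.IsUnramified) : (χ⁻¹).IsUnramified :=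
  fun x hx => by
    change (χ x)⁻¹ = 1
    rw [hχ x hx, inv_one]

variable [MeasurableSpace F] [BorelSpace F]

/-- **The zeta integral over one shell for unramified `χ`** (Tate 1950, §2.5:
"`∫_{A_ν} |α|^s dα = N𝔭^{-νs} ∫_u dα`"): `∫_{A_k} χ(x) |x|^s d^×x = μ'(𝒪ˣ) (χ(ϖ) q^{-s})^k`.
[cite: Tate1950, §2.5] -/
theorem setIntegral_shell_quasiChar_cpow_of_isUnramified (μ' : Measure Fˣ)
    [μ'.IsMulLeftInvariant] {χ : QuasiChar F} (hχ : χ.IsUnramified) {ϖ : F} (hϖ0 : ϖ ≠ 0)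
    (hϖ : normAbs F ϖ = (residueFieldCard F : ℝ≥0)⁻¹) (k : ℤ) (s : ℂ) :
    ∫ x in {x : Fˣ | normAbs F (x : F) = (residueFieldCard F : ℝ≥0)⁻¹ ^ k},
        ((χ x : ℂˣ) : ℂ) * (((normAbs F (x : F) : ℝ≥0) : ℝ) : ℂ) ^ s ∂μ' =
      (μ'.real {x : Fˣ | valuation F (x : F) = 1} : ℂ) *
        (((χ (Units.mk0 ϖ hϖ0) : ℂˣ) : ℂ) * (residueFieldCard F : ℂ) ^ (-s)) ^ k := by
  set w : Fˣ := Units.mk0 ϖ hϖ0 with hw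
  have hconst : ∀ x ∈ {x : Fˣ | normAbs F (x : F) = (residueFieldCard F : ℝ≥0)⁻¹ ^ k},
      ((χ x : ℂˣ) : ℂ) * (((normAbs F (x : F) : ℝ≥0) : ℝ) : ℂ) ^ s =
        (((χ w : ℂˣ) : ℂ) * (residueFieldCard F : ℂ) ^ (-s)) ^ k := by
    intro x hx
    have hx' := hx
    rw [shell_eq_smul_unitSphere hϖ hϖ0 k, Set.mem_smul_set] at hx'
    obtain ⟨u, hu, rfl⟩ := hx'
    rw [Set.mem_setOf_eq, ← normAbs_eq_one_iff_valuation_eq_one] at hu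
    rw [Set.mem_setOf_eq] at hx
    rw [normAbs_cpow_eq_of_eq_zpow hx, smul_eq_mul, map_mul, hχ u hu, mul_one, map_zpow,
      Units.val_zpow_eq_zpow_val, mul_zpow]
  rw [setIntegral_congr_fun (measurableSet_normAbs_shell k) hconst, setIntegral_const,
    Complex.real_smul, measureReal_def, measure_shell μ' k, ← measureReal_def]

/-- **The zeta integral of `1_{𝔭^k}` for unramified `χ`** (Tate 1950, §2.5, the unramified
computation: "`ζ(f₀, |·|^s) = ∑_ν N𝔭^{-νs} ∫_u dα = N𝔭^{ds}/(1 - N𝔭^{-s}) · N𝔡^{-1/2}`"): for `χ`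
of exponent `σ`, `|ϖ| = q⁻¹` and `re s > -σ`,
`Z(1_{𝔭^k}, χ, s) = μ'(𝒪ˣ) (χ(ϖ)T)^k / (1 - χ(ϖ)T)`, `T = q^{-s}`. [cite: Tate1950, §2.5] -/
theorem tateZeta_indicator_primePowBall_of_isUnramified (μ' : Measure Fˣ) [μ'.IsHaarMeasure]
    {χ : QuasiChar F} (hχ : χ.IsUnramified) {σ : ℝ} (hσ : χ.HasExponent σ) {ϖ : F}
    (hϖ0 : ϖ ≠ 0) (hϖ : normAbs F ϖ = (residueFieldCard F : ℝ≥0)⁻¹) (k : ℤ) {s : ℂ}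
    (hs : -σ < s.re) :
    tateZeta μ' ((primePowBall F k).indicator fun _ => (1 : ℂ)) χ s =
      (μ'.real {x : Fˣ | valuation F (x : F) = 1} : ℂ) *
        (((χ (Units.mk0 ϖ hϖ0) : ℂˣ) : ℂ) * (residueFieldCard F : ℂ) ^ (-s)) ^ k /
          (1 - ((χ (Units.mk0 ϖ hϖ0) : ℂˣ) : ℂ) * (residueFieldCard F : ℂ) ^ (-s)) := by
  set r : ℂ := ((χ (Units.mk0 ϖ hϖ0) : ℂˣ) : ℂ) * (residueFieldCard F : ℂ) ^ (-s) with hr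
  set c : ℂ := (μ'.real {x : Fˣ | valuation F (x : F) = 1} : ℂ) with hc
  set G : Fˣ → ℂ := fun x => ((χ x : ℂˣ) : ℂ) * (((normAbs F (x : F) : ℝ≥0) : ℝ) : ℂ) ^ s with hG
  set S : ℕ → Set Fˣ := fun j =>
    {x : Fˣ | normAbs F (x : F) = (residueFieldCard F : ℝ≥0)⁻¹ ^ (k + (j : ℤ))} with hS
  have hr1 : ‖r‖ < 1 := norm_quasiChar_mul_cpow_lt_one hσ hϖ0 hϖ hs
  have hr0 : r ≠ 0 := mul_ne_zero (χ _).ne_zero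
    (Complex.cpow_ne_zero_iff.2 (Or.inl (Nat.cast_ne_zero.2 (residueFieldCard_ne_zero F))))
  -- the zeta integral as an integral over `{x | x ∈ 𝔭^k} = ⋃ S j`
  set B : Set Fˣ := {x : Fˣ | (x : F) ∈ primePowBall F k} with hB
  have hind : (fun x : Fˣ => (primePowBall F k).indicator (fun _ => (1 : ℂ)) (x : F) *
      ((χ x : ℂˣ) : ℂ) * (((normAbs F (x : F) : ℝ≥0) : ℝ) : ℂ) ^ s) = B.indicator G := by
    ext x
    by_cases hx : (x : F) ∈ primePowBall F k
    · rw [Set.indicator_of_mem hx, Set.indicator_of_mem (show x ∈ B from hx), one_mul]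
    · rw [Set.indicator_of_notMem hx, Set.indicator_of_notMem (show x ∉ B from hx),
        zero_mul, zero_mul]
  have h1 : tateZeta μ' ((primePowBall F k).indicator fun _ => (1 : ℂ)) χ s =
      ∫ x in ⋃ j, S j, G x ∂μ' := by
    rw [tateZeta, hind, integral_indicator (measurableSet_units_mem_primePowBall k),
      setOf_units_mem_primePowBall_eq_iUnion]
  have hint : IntegrableOn G (⋃ j, S j) μ' := by
    rw [← setOf_units_mem_primePowBall_eq_iUnion,
      ← integrable_indicator_iff (measurableSet_units_mem_primePowBall k), ← hind]
    exact integrable_tateZetaIntegrand μ' (indicator_primePowBall_mem_schwartzBruhat k 1) hσ hs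
  have hdisj : Pairwise (Disjoint on S) := fun i j hij =>
    pairwise_disjoint_shell (show k + (i : ℤ) ≠ k + (j : ℤ) by omega)
  have hsum := hasSum_integral_iUnion (μ := μ') (f := G)
    (fun j : ℕ => measurableSet_normAbs_shell (k + (j : ℤ))) hdisj hint
  have hterm : ∀ j : ℕ, ∫ x in S j, G x ∂μ' = c * r ^ k * r ^ j := fun j => by
    rw [hS, hG, setIntegral_shell_quasiChar_cpow_of_isUnramified μ' hχ hϖ0 hϖ, zpow_add₀ hr0,
      zpow_natCast, mul_assoc]
  have hgeom : HasSum (fun j : ℕ => ∫ x in S j, G x ∂μ') (c * r ^ k / (1 - r)) := by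
    simp_rw [hterm, div_eq_mul_inv]
    exact (hasSum_geometric_of_norm_lt_one hr1).mul_left (c * r ^ k)
  rw [h1]
  exact hsum.unique hgeom

/-- If `x.denom ∣ D` and `D(t) ≠ 0` then the denominator of `x` does not vanish at `t` (the
form consumed by `RatFunc.eval_mul`). [folklore] -/
theorem eval₂_denom_ne_zero_of_dvd {x : RatFunc ℂ} {D : ℂ[X]} (h : x.denom ∣ D) {t : ℂ}
    (hD : D.eval t ≠ 0) : Polynomial.eval₂ (RingHom.id ℂ) t x.denom ≠ 0 := by
  obtain ⟨k, hk⟩ := h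
  rw [Polynomial.eval₂_id]
  intro h0
  apply hD
  rw [hk, eval_mul, h0, zero_mul]

/-- `q^{-(1-s)} = q⁻¹ (q^{-s})⁻¹` (`T ↦ q⁻¹T⁻¹` is `s ↦ 1 - s`). [folklore] -/
theorem cpow_neg_one_sub {q : ℕ} (hq : q ≠ 0) (s : ℂ) :
    (q : ℂ) ^ (-(1 - s)) = (q : ℂ)⁻¹ * ((q : ℂ) ^ (-s))⁻¹ := by
  have hq0 : (q : ℂ) ≠ 0 := Nat.cast_ne_zero.2 hq
  rw [show -(1 - s) = (-1 : ℂ) + - -s by ring, Complex.cpow_add _ _ hq0, Complex.cpow_neg_one,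
    Complex.cpow_neg _ (-s)]

omit [MeasurableSpace F] [BorelSpace F] in
/-- **The `L`-ratio of an unramified `χ` as a quotient of polynomials**: if
`P_χ = 1 - αT` and `P_{χ⁻¹} = 1 - α⁻¹T`, then
`L(1-s, χ⁻¹)/L(s, χ) = T (1 - αT) / (T - α⁻¹q⁻¹)` in `ℂ(T)`. [folklore] -/
theorem tateLRatDual_div_tateLRat_eq {χ : QuasiChar F} {α : ℂ}
    (hP : tateEulerFactor χ = 1 - Polynomial.C α * X)
    (hP' : tateEulerFactor χ⁻¹ = 1 - Polynomial.C α⁻¹ * X) :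
    tateLRatDual χ / tateLRat χ =
      algebraMap ℂ[X] (RatFunc ℂ) (X * (1 - Polynomial.C α * X)) /
        algebraMap ℂ[X] (RatFunc ℂ) (X - Polynomial.C (α⁻¹ * (residueFieldCard F : ℂ)⁻¹)) := by
  have hX : (RatFunc.X : RatFunc ℂ) ≠ 0 := RatFunc.X_ne_zero
  set δ : ℂ := α⁻¹ * (residueFieldCard F : ℂ)⁻¹ with hδ
  have hD : (RatFunc.X : RatFunc ℂ) - RatFunc.C δ ≠ 0 := by
    intro h
    have h1 := congrArg RatFunc.intDegree (sub_eq_zero.1 h)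
    rw [RatFunc.intDegree_X, RatFunc.intDegree_C] at h1
    exact one_ne_zero h1
  have hA : (1 - RatFunc.C α⁻¹ * (RatFunc.C ((residueFieldCard F : ℂ)⁻¹) * RatFunc.X⁻¹) :
      RatFunc ℂ) = (RatFunc.X - RatFunc.C δ) * RatFunc.X⁻¹ := by
    rw [hδ, map_mul, sub_mul, mul_inv_cancel₀ hX]
    ring
  have hA0 : (1 - RatFunc.C α⁻¹ * (RatFunc.C ((residueFieldCard F : ℂ)⁻¹) * RatFunc.X⁻¹) :
      RatFunc ℂ) ≠ 0 := by
    rw [hA]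
    exact mul_ne_zero hD (inv_ne_zero hX)
  rw [tateLRatDual, tateLRat, dualVar, hP, hP']
  simp only [map_sub, map_one, map_mul, Polynomial.aeval_C, Polynomial.aeval_X,
    RatFunc.algebraMap_X, RatFunc.algebraMap_C, RatFunc.algebraMap_eq_C]
  rw [div_eq_mul_inv, inv_inv, hA, mul_inv, inv_inv, eq_div_iff hD]
  calc (RatFunc.X - RatFunc.C δ)⁻¹ * RatFunc.X * (1 - RatFunc.C α * RatFunc.X) *
        (RatFunc.X - RatFunc.C δ)
      = RatFunc.X * (1 - RatFunc.C α * RatFunc.X) *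
          ((RatFunc.X - RatFunc.C δ)⁻¹ * (RatFunc.X - RatFunc.C δ)) := by ring
    _ = RatFunc.X * (1 - RatFunc.C α * RatFunc.X) := by rw [inv_mul_cancel₀ hD, mul_one]

omit [MeasurableSpace F] [BorelSpace F] in
/-- **`γ(q^{-s})` for unramified `χ`**: with `P_χ = 1 - αT`, `P_{χ⁻¹} = 1 - α⁻¹T` and
`T = q^{-s} ≠ α⁻¹q⁻¹`, the rational function `e T^a · L(1-s, χ⁻¹)/L(s, χ)` evaluates at `q^{-s}` to
`e T^a (1 - αT) / (1 - α⁻¹q⁻¹T⁻¹)`. [folklore] -/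
theorem evalAtQ_tateEpsilonRat_mul_div_of_isUnramified {χ : QuasiChar F} {α : ℂ} (hα : α ≠ 0)
    (hP : tateEulerFactor χ = 1 - Polynomial.C α * X)
    (hP' : tateEulerFactor χ⁻¹ = 1 - Polynomial.C α⁻¹ * X) (e : ℂ) (a : ℤ) {s : ℂ}
    (hT : (residueFieldCard F : ℂ) ^ (-s) ≠ α⁻¹ * (residueFieldCard F : ℂ)⁻¹) :
    evalAtQ (residueFieldCard F) (tateEpsilonRat e a * tateLRatDual χ / tateLRat χ) s =
      e * ((residueFieldCard F : ℂ) ^ (-s)) ^ a * (1 - α * (residueFieldCard F : ℂ) ^ (-s)) /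
        (1 - α⁻¹ * (residueFieldCard F : ℂ)⁻¹ * ((residueFieldCard F : ℂ) ^ (-s))⁻¹) := by
  have hq : residueFieldCard F ≠ 0 := residueFieldCard_ne_zero F
  set T : ℂ := (residueFieldCard F : ℂ) ^ (-s) with hTdef
  have hT0 : T ≠ 0 := Complex.cpow_ne_zero_iff.2 (Or.inl (Nat.cast_ne_zero.2 hq))
  set δ : ℂ := α⁻¹ * (residueFieldCard F : ℂ)⁻¹ with hδ
  have hTδ : T - δ ≠ 0 := sub_ne_zero.2 hT
  set N : ℂ[X] := X * (1 - Polynomial.C α * X) with hN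
  set D : ℂ[X] := X - Polynomial.C δ with hDdef
  have hDev : D.eval T ≠ 0 := by rwa [hDdef, eval_sub, eval_X, eval_C]
  -- the `ε`-monomial as a quotient of polynomials, for its denominator
  have hε : tateEpsilonRat e a = algebraMap ℂ[X] (RatFunc ℂ) (Polynomial.C e * X ^ a.toNat) /
      algebraMap ℂ[X] (RatFunc ℂ) (X ^ (-a).toNat) := by
    rw [tateEpsilonRat, ratFunc_X_zpow_eq_div, map_mul, RatFunc.algebraMap_C, mul_div_assoc]
  have hεden : Polynomial.eval₂ (RingHom.id ℂ) T (tateEpsilonRat e a).denom ≠ 0 := by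
    rw [hε]
    refine eval₂_denom_ne_zero_of_dvd (RatFunc.denom_div_dvd _ _) ?_
    rw [eval_pow, eval_X]
    exact pow_ne_zero _ hT0
  have hRden : Polynomial.eval₂ (RingHom.id ℂ) T (tateLRatDual χ / tateLRat χ).denom ≠ 0 := by
    rw [tateLRatDual_div_tateLRat_eq hP hP']
    exact eval₂_denom_ne_zero_of_dvd (RatFunc.denom_div_dvd _ _) hDev
  rw [mul_div_assoc, evalAtQ, RatFunc.eval_mul (RingHom.id ℂ) _ hεden hRden]
  change evalAtQ (residueFieldCard F) (tateEpsilonRat e a) s *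
    evalAtQ (residueFieldCard F) (tateLRatDual χ / tateLRat χ) s = _
  rw [evalAtQ_tateEpsilonRat hq, tateLRatDual_div_tateLRat_eq hP hP',
    evalAtQ_div_of_eval_ne_zero _ N D hDev]
  simp only [hN, hDdef, eval_mul, eval_sub, eval_X, eval_C, eval_one]
  rw [← hTdef]
  rw [hδ] at hTδ
  have h2 : 1 - α⁻¹ * (residueFieldCard F : ℂ)⁻¹ * T⁻¹ ≠ 0 := by
    intro h0
    apply hTδ
    calc T - α⁻¹ * (residueFieldCard F : ℂ)⁻¹
        = T * (1 - α⁻¹ * (residueFieldCard F : ℂ)⁻¹ * T⁻¹) := by field_simp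
      _ = 0 := by rw [h0, mul_zero]
  field_simp

omit [BorelSpace F] in
/-- `μ'(𝒪ˣ)` is a non-zero real number for a Haar measure. [folklore] -/
theorem measureReal_unitSphere_ne_zero (μ' : Measure Fˣ) [μ'.IsHaarMeasure] :
    μ'.real {x : Fˣ | valuation F (x : F) = 1} ≠ 0 :=
  (ENNReal.toReal_pos (measure_unitSphere_pos μ').ne' (measure_unitSphere_lt_top μ').ne).ne'

/-- **Tate's local functional equation for unramified `χ`** (Tate 1950, §2.5, the unramified
computation "`ρ(|·|^s) = N𝔡^{s-1/2} (1 - N𝔭^{s-1})/(1 - N𝔭^{-s})`", in the conventions of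
`TateLocalFactors`): for `ψ` of conductor exponent `m`, Haar measures `μ`, `μ'`, an unramified `χ`
and a uniformiser `ϖ` normalising the Euler factors `P_χ = 1 - χ(ϖ)T`, `P_{χ⁻¹} = 1 - χ(ϖ)⁻¹T`,
the `ε`-factor is `ε(s, χ, ψ) = μ(𝔭^m) χ(ϖ)^{-m} q^{ms}`:
`HasTateEpsilon ψ μ μ' χ (μ(𝔭^m) χ(ϖ)^{-m}) (-m)` — the test function is `g = 1_{𝔭^m}`,
`ĝ = μ(𝔭^m) 1_𝒪`. [cite: Tate1950, §2.5] -/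
theorem hasTateEpsilon_of_isUnramified (μ : Measure F) [μ.IsAddHaarMeasure] (μ' : Measure Fˣ)
    [μ'.IsHaarMeasure] {ψ : AddChar F Circle} (hψ : ψ.IsContinuousNontrivial) {m : ℤ}
    (hm : ψ.HasConductorExp m) {χ : QuasiChar F} (hχ : χ.IsUnramified) {ϖ : F} (hϖ0 : ϖ ≠ 0)
    (hϖ : normAbs F ϖ = (residueFieldCard F : ℝ≥0)⁻¹)
    (hP : tateEulerFactor χ = 1 - Polynomial.C ((χ (Units.mk0 ϖ hϖ0) : ℂˣ) : ℂ) * X)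
    (hP' : tateEulerFactor χ⁻¹ = 1 - Polynomial.C ((χ (Units.mk0 ϖ hϖ0) : ℂˣ) : ℂ)⁻¹ * X) :
    HasTateEpsilon ψ μ μ' χ
      ((μ.real (primePowBall F m) : ℂ) * ((χ (Units.mk0 ϖ hϖ0) : ℂˣ) : ℂ) ^ (-m)) (-m) := by
  have hq : residueFieldCard F ≠ 0 := residueFieldCard_ne_zero F
  have hq0 : (residueFieldCard F : ℂ) ≠ 0 := Nat.cast_ne_zero.2 hq
  set α : ℂ := ((χ (Units.mk0 ϖ hϖ0) : ℂˣ) : ℂ) with hαdef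
  have hα : α ≠ 0 := (χ _).ne_zero
  have hαinv : ((χ⁻¹ (Units.mk0 ϖ hϖ0) : ℂˣ) : ℂ) = α⁻¹ := by
    change (((χ (Units.mk0 ϖ hϖ0))⁻¹ : ℂˣ) : ℂ) = α⁻¹
    rw [Units.val_inv_eq_inv_val]
  set g : F → ℂ := (primePowBall F m).indicator fun _ => (1 : ℂ) with hgdef
  have hg : g ∈ SchwartzBruhat F := indicator_primePowBall_mem_schwartzBruhat m 1
  have hĝ : fourierSB ψ μ g = fun y => (μ.real (primePowBall F m) : ℂ) *
      (primePowBall F 0).indicator (fun _ => (1 : ℂ)) y := by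
    classical
    ext y
    rw [hgdef, fourierSB_indicator_primePowBall μ hm m y, sub_self]
    by_cases hy : y ∈ primePowBall F 0
    · rw [if_pos hy, Set.indicator_of_mem hy, mul_one]
    · rw [if_neg hy, Set.indicator_of_notMem hy, mul_zero]
  set c : ℂ := (μ'.real {x : Fˣ | valuation F (x : F) = 1} : ℂ) with hcdef
  have hc : c ≠ 0 := by
    rw [hcdef]
    exact_mod_cast measureReal_unitSphere_ne_zero μ'
  have hB : (μ.real (primePowBall F m) : ℂ) ≠ 0 := by
    exact_mod_cast (ENNReal.toReal_pos (addHaar_primePowBall_pos μ m).ne'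
      (measure_primePowBall_lt_top μ m).ne).ne'
  refine hasTateGamma_of_test μ μ' hψ hg fun σ hσ s hs1 hs2 => ?_
  set T : ℂ := (residueFieldCard F : ℂ) ^ (-s) with hTdef
  set T' : ℂ := (residueFieldCard F : ℂ) ^ (-(1 - s)) with hT'def
  have hT0 : T ≠ 0 := Complex.cpow_ne_zero_iff.2 (Or.inl hq0)
  have hr1 : ‖α * T‖ < 1 := norm_quasiChar_mul_cpow_lt_one hσ hϖ0 hϖ hs1
  have hr'1 : ‖α⁻¹ * T'‖ < 1 := by
    rw [← hαinv]
    exact norm_quasiChar_mul_cpow_lt_one hσ.inv hϖ0 hϖ (by rw [Complex.sub_re, Complex.one_re]; linarith)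
  have hr0 : α * T ≠ 0 := mul_ne_zero hα hT0
  have h1r : 1 - α * T ≠ 0 := fun h => by
    rw [sub_eq_zero] at h
    rw [← h, norm_one] at hr1
    exact lt_irrefl _ hr1
  have h1r' : 1 - α⁻¹ * T' ≠ 0 := fun h => by
    rw [sub_eq_zero] at h
    rw [← h, norm_one] at hr'1
    exact lt_irrefl _ hr'1
  have hTT' : T' = (residueFieldCard F : ℂ)⁻¹ * T⁻¹ := cpow_neg_one_sub hq s
  -- the two zeta integrals
  have hZg : tateZeta μ' g χ s = c * (α * T) ^ m / (1 - α * T) :=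
    tateZeta_indicator_primePowBall_of_isUnramified μ' hχ hσ hϖ0 hϖ m hs1
  have hZĝ : tateZeta μ' (fourierSB ψ μ g) χ⁻¹ (1 - s) =
      (μ.real (primePowBall F m) : ℂ) * (c / (1 - α⁻¹ * T')) := by
    rw [hĝ, tateZeta_const_mul, tateZeta_indicator_primePowBall_of_isUnramified μ' hχ.inv hσ.inv
      hϖ0 hϖ 0 (by rw [Complex.sub_re, Complex.one_re]; linarith), zpow_zero, mul_one, hαinv]
  refine ⟨by rw [hZg]; exact div_ne_zero (mul_ne_zero hc (zpow_ne_zero _ hr0)) h1r, ?_⟩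
  have hTne : T ≠ α⁻¹ * (residueFieldCard F : ℂ)⁻¹ := fun h => h1r' (by
    rw [hTT', h, mul_inv, inv_inv, inv_inv]
    field_simp
    ring)
  rw [hZĝ, hZg, evalAtQ_tateEpsilonRat_mul_div_of_isUnramified hα hP hP' _ _ hTne, ← hTdef, hTT',
    mul_zpow, zpow_neg α, zpow_neg T]
  have hαm : α ^ m ≠ 0 := zpow_ne_zero _ hα
  have hTm : T ^ m ≠ 0 := zpow_ne_zero _ hT0
  field_simp

end Unramified


/-! ### §2.5, the ramified case -/

section Ramified

/-- For `n ≥ 1`, `U^n = {x | x - 1 ∈ 𝔭^n}` as a set. [folklore] -/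
theorem unitFiltration_eq_preimage {n : ℕ} (hn : 1 ≤ n) :
    unitFiltration F n = (fun x : Fˣ => (x : F) - 1) ⁻¹' primePowBall F (n : ℤ) :=
  Set.ext fun x => mem_unitFiltration_iff_sub_one_mem hn x

/-- `U^n` is open (`n ≥ 1`). [folklore] -/
theorem isOpen_unitFiltration {n : ℕ} (hn : 1 ≤ n) : IsOpen (unitFiltration F n) := by
  rw [unitFiltration_eq_preimage hn]
  exact (isOpen_primePowBall _).preimage (Units.continuous_val.sub continuous_const)

/-- `U^n` is closed (`n ≥ 1`). [folklore] -/
theorem isClosed_unitFiltration {n : ℕ} (hn : 1 ≤ n) : IsClosed (unitFiltration F n) := by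
  rw [unitFiltration_eq_preimage hn]
  exact (isClosed_primePowBall _).preimage (Units.continuous_val.sub continuous_const)

/-- `U^n` is compact (`n ≥ 1`; a closed subset of `𝒪ˣ`). [folklore] -/
theorem isCompact_unitFiltration {n : ℕ} (hn : 1 ≤ n) : IsCompact (unitFiltration F n) :=
  (isCompact_shell 0).of_isClosed_subset (isClosed_unitFiltration hn) fun x hx => by
    rw [Set.mem_setOf_eq, zpow_zero]
    exact hx.1

/-- `1 ∈ U^n`. [folklore] -/
theorem one_mem_unitFiltration (n : ℕ) : (1 : Fˣ) ∈ unitFiltration F n :=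
  ⟨by rw [Units.val_one, map_one], by rw [Units.val_one, sub_self, map_zero]; exact zero_le⟩

/-- A quasi-character of conductor exponent `c ≥ 1` is ramified. [folklore] -/
theorem QuasiChar.HasConductorExp.not_isUnramified {χ : QuasiChar F} {c : ℕ}
    (hc : χ.HasConductorExp c) (hc1 : 1 ≤ c) : ¬ χ.IsUnramified := by
  intro h
  obtain ⟨x, hx, hne⟩ := hc.2 0 (by omega)
  exact hne (h x hx.1)

/-- `χ⁻¹` has the same conductor exponent as `χ`. [folklore] -/
theorem QuasiChar.HasConductorExp.inv {χ : QuasiChar F} {c : ℕ} (hc : χ.HasConductorExp c) :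
    (χ⁻¹).HasConductorExp c := by
  refine ⟨fun x hx => ?_, fun b hb => ?_⟩
  · change (χ x)⁻¹ = 1
    rw [hc.1 x hx, inv_one]
  · obtain ⟨x, hx, hne⟩ := hc.2 b hb
    exact ⟨x, hx, fun h => hne (inv_eq_one.1 h)⟩

/-- `ψ · 1_{𝔭^n}` is Schwartz–Bruhat (`ψ` of conductor exponent `m` is constant on cosets of
`𝔭^m`). [folklore] -/
theorem addChar_mul_indicator_mem_schwartzBruhat {ψ : AddChar F Circle} {m : ℤ}
    (hm : ψ.HasConductorExp m) (n : ℤ) :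
    (fun y => ((ψ y : Circle) : ℂ) * (primePowBall F n).indicator (fun _ => (1 : ℂ)) y) ∈
      SchwartzBruhat F := by
  have hψ : IsLocallyConstant fun y : F => ((ψ y : Circle) : ℂ) := by
    rw [IsLocallyConstant.iff_exists_open]
    intro y
    refine ⟨y +ᵥ primePowBall F m, (isOpen_primePowBall m).vadd _,
      Set.mem_vadd_set.2 ⟨0, zero_mem_primePowBall _, by simp⟩, ?_⟩
    rintro y' ⟨k, hk, rfl⟩
    dsimp only
    rw [vadd_eq_add, AddChar.map_add_eq_mul, hm.1 k hk, mul_one]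
  have hind := (mem_schwartzBruhat_iff).1 (indicator_primePowBall_mem_schwartzBruhat (F := F) n 1)
  exact (mem_schwartzBruhat_iff).2 ⟨hψ.mul hind.1, hind.2.mul_left⟩

variable [MeasurableSpace F] [BorelSpace F]

/-- `U^n` is measurable (`n ≥ 1`). [folklore] -/
theorem measurableSet_unitFiltration {n : ℕ} (hn : 1 ≤ n) : MeasurableSet (unitFiltration F n) := by
  haveI : BorelSpace Fˣ := Units.borelSpace
  exact (isOpen_unitFiltration hn).measurableSet

omit [BorelSpace F] in
/-- `μ'(U^n)` is a non-zero real number for a Haar measure `μ'` (`n ≥ 1`). [folklore] -/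
theorem measureReal_unitFiltration_ne_zero (μ' : Measure Fˣ) [μ'.IsHaarMeasure] {n : ℕ}
    (hn : 1 ≤ n) : μ'.real (unitFiltration F n) ≠ 0 :=
  (ENNReal.toReal_pos ((isOpen_unitFiltration hn).measure_pos μ' ⟨1, one_mem_unitFiltration n⟩).ne'
    (isCompact_unitFiltration hn).measure_lt_top.ne).ne'

/-- **The zeta integral of `1_{1+𝔭^c}` is the constant `μ'(U^c)`** when `χ` is trivial on
`U^c = 1 + 𝔭^c` (`c ≥ 1`) (Tate 1950, §2.5: "`ζ(f̂_n, ĉ) = N𝔡^{1/2} N𝔭^n ∫_{1+𝔭^n} dα`, a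
constant!"). [cite: Tate1950, §2.5] -/
theorem tateZeta_indicator_one_vadd_primePowBall (μ' : Measure Fˣ) {χ : QuasiChar F} {c : ℕ}
    (hc1 : 1 ≤ c) (hχ : ∀ x ∈ unitFiltration F c, χ x = 1) (s : ℂ) :
    tateZeta μ' (((1 : F) +ᵥ primePowBall F (c : ℤ)).indicator fun _ => (1 : ℂ)) χ s =
      (μ'.real (unitFiltration F c) : ℂ) := by
  have hint : ∀ x : Fˣ, ((1 : F) +ᵥ primePowBall F (c : ℤ)).indicator (fun _ => (1 : ℂ)) (x : F) *
      ((χ x : ℂˣ) : ℂ) * (((normAbs F (x : F) : ℝ≥0) : ℝ) : ℂ) ^ s =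
        (unitFiltration F c).indicator (fun _ => (1 : ℂ)) x := by
    intro x
    by_cases hx : x ∈ unitFiltration F c
    · have hx' : (x : F) ∈ (1 : F) +ᵥ primePowBall F (c : ℤ) :=
        Set.mem_vadd_set.2 ⟨(x : F) - 1, (mem_unitFiltration_iff_sub_one_mem hc1 x).1 hx,
          by rw [vadd_eq_add, add_sub_cancel]⟩
      rw [Set.indicator_of_mem hx', Set.indicator_of_mem hx, hχ x hx, hx.1]
      simp
    · have hx' : (x : F) ∉ (1 : F) +ᵥ primePowBall F (c : ℤ) := fun h => hx (by
        obtain ⟨b, hb, hbx⟩ := Set.mem_vadd_set.1 h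
        refine (mem_unitFiltration_iff_sub_one_mem hc1 x).2 ?_
        rw [← hbx, vadd_eq_add, add_sub_cancel_left]
        exact hb)
      rw [Set.indicator_of_notMem hx', Set.indicator_of_notMem hx, zero_mul, zero_mul]
  rw [tateZeta, integral_congr_ae (ae_of_all _ hint), integral_indicator_const _
    (measurableSet_unitFiltration hc1), Complex.real_smul, mul_one]

/-- **Tate's averaging argument** (Tate 1950, §2.5, cases 1 and 2: the shells `A_ν`,
`ν > -d - n`, contribute nothing to `ζ(f_n, c_n |·|^s)`): for `ψ` of conductor exponent `m`, `η`
of conductor exponent `c ≥ 1` and `k > m - c`, `∫_{A_k} ψ(x) η(x) |x|^w d^×x = 0` — multiply by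
`u ∈ U^{max(m-k,0)}` with `η(u) ≠ 1`, which fixes `A_k`, `ψ` and `|·|` there.
[cite: Tate1950, §2.5] -/
theorem setIntegral_shell_addChar_quasiChar_eq_zero (μ' : Measure Fˣ) [μ'.IsMulLeftInvariant]
    {ψ : AddChar F Circle} {m : ℤ} (hm : ψ.HasConductorExp m) {η : QuasiChar F} {c : ℕ}
    (hc : η.HasConductorExp c) (hc1 : 1 ≤ c) {k : ℤ} (hk : m - c < k) (w : ℂ) :
    ∫ x in {x : Fˣ | normAbs F (x : F) = (residueFieldCard F : ℝ≥0)⁻¹ ^ k},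
      ((ψ (x : F) : Circle) : ℂ) * ((η x : ℂˣ) : ℂ) * (((normAbs F (x : F) : ℝ≥0) : ℝ) : ℂ) ^ w ∂μ' = 0 := by
  set b : ℕ := (m - k).toNat with hb
  have hbc : b < c := by omega
  have hbk : m ≤ (b : ℤ) + k := by omega
  obtain ⟨u, hu, hne⟩ := hc.2 b hbc
  have hu1 : normAbs F (u : F) = 1 := hu.1
  refine setIntegral_eq_zero_of_mul_left μ' (measurableSet_normAbs_shell k) (u := u)
    (fun x => ?_) (c := ((η u : ℂˣ) : ℂ)) (fun h => hne (Units.val_eq_one.1 h)) fun x hx => ?_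
  · simp only [Set.mem_setOf_eq, Units.val_mul, map_mul, hu1, one_mul]
  · rw [Set.mem_setOf_eq] at hx
    have hshift : (u : F) * x = x + ((u : F) - 1) * x := by ring
    have hmem : ((u : F) - 1) * x ∈ primePowBall F m := by
      have h1 : ((u : F) - 1) ∈ primePowBall F (b : ℤ) := by
        rw [mem_primePowBall_iff, zpow_natCast]
        exact hu.2
      have h2 : (x : F) ∈ primePowBall F k := by
        rw [mem_primePowBall_iff, hx]
      exact primePowBall_antitone hbk (mul_mem_primePowBall h1 h2)
    rw [Units.val_mul, hshift, AddChar.map_add_eq_mul, hm.1 _ hmem, mul_one, ← hshift,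
      map_mul (normAbs F), hu1, one_mul, map_mul η, Units.val_mul]
    ring

/-- **The zeta integral of `ψ · 1_{𝔭^{m-c}}` for ramified `η`** (Tate 1950, §2.5, the ramified
computation: "`ζ(f_n, c_n|·|^s) = N𝔭^{(d+n)s} ∫_{A_{-d-n}} e^{2πiΛ(α)} c_n(α) dα`"): for `ψ` of
conductor exponent `m`, `η` of conductor exponent `c ≥ 1` and exponent `σ`, and `re w > -σ`,
`Z(ψ 1_{𝔭^{m-c}}, η, w) = (q^{-w})^{m-c} ∫_{A_{m-c}} ψ η d^×x` (the shell `A_{m-c}` carries a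
Gauss sum, all deeper shells vanish). [cite: Tate1950, §2.5] -/
theorem tateZeta_addChar_mul_indicator_primePowBall (μ' : Measure Fˣ) [μ'.IsHaarMeasure]
    {ψ : AddChar F Circle} {m : ℤ} (hm : ψ.HasConductorExp m) {η : QuasiChar F} {c : ℕ}
    (hc : η.HasConductorExp c) (hc1 : 1 ≤ c) {σ : ℝ} (hσ : η.HasExponent σ) {w : ℂ}
    (hw : -σ < w.re) :
    tateZeta μ' (fun y => ((ψ y : Circle) : ℂ) *
        (primePowBall F (m - c)).indicator (fun _ => (1 : ℂ)) y) η w =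
      ((residueFieldCard F : ℂ) ^ (-w)) ^ (m - c) *
        ∫ x in {x : Fˣ | normAbs F (x : F) = (residueFieldCard F : ℝ≥0)⁻¹ ^ (m - c)},
          ((ψ (x : F) : Circle) : ℂ) * ((η x : ℂˣ) : ℂ) ∂μ' := by
  set n : ℤ := m - c with hn
  set K : Fˣ → ℂ := fun x =>
    ((ψ (x : F) : Circle) : ℂ) * ((η x : ℂˣ) : ℂ) * (((normAbs F (x : F) : ℝ≥0) : ℝ) : ℂ) ^ w with hK
  set B : Set Fˣ := {x : Fˣ | (x : F) ∈ primePowBall F n} with hB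
  set S : ℕ → Set Fˣ := fun j =>
    {x : Fˣ | normAbs F (x : F) = (residueFieldCard F : ℝ≥0)⁻¹ ^ (n + (j : ℤ))} with hS
  have hind : (fun x : Fˣ => ((ψ (x : F) : Circle) : ℂ) *
      (primePowBall F n).indicator (fun _ => (1 : ℂ)) (x : F) * ((η x : ℂˣ) : ℂ) *
        (((normAbs F (x : F) : ℝ≥0) : ℝ) : ℂ) ^ w) = B.indicator K := by
    ext x
    by_cases hx : (x : F) ∈ primePowBall F n
    · rw [Set.indicator_of_mem hx, Set.indicator_of_mem (show x ∈ B from hx), mul_one]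
    · rw [Set.indicator_of_notMem hx, Set.indicator_of_notMem (show x ∉ B from hx), mul_zero,
        zero_mul, zero_mul]
  have h1 : tateZeta μ' (fun y => ((ψ y : Circle) : ℂ) *
      (primePowBall F n).indicator (fun _ => (1 : ℂ)) y) η w = ∫ x in ⋃ j, S j, K x ∂μ' := by
    rw [tateZeta, hind, integral_indicator (measurableSet_units_mem_primePowBall n),
      setOf_units_mem_primePowBall_eq_iUnion]
  have hint : IntegrableOn K (⋃ j, S j) μ' := by
    rw [← setOf_units_mem_primePowBall_eq_iUnion,
      ← integrable_indicator_iff (measurableSet_units_mem_primePowBall n), ← hB, ← hind]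
    exact integrable_tateZetaIntegrand μ' (addChar_mul_indicator_mem_schwartzBruhat hm n) hσ hw
  have hdisj : Pairwise (Disjoint on S) := fun i j hij =>
    pairwise_disjoint_shell (show n + (i : ℤ) ≠ n + (j : ℤ) by omega)
  have hsum := hasSum_integral_iUnion (μ := μ') (f := K)
    (fun j : ℕ => measurableSet_normAbs_shell (n + (j : ℤ))) hdisj hint
  -- the shell `j = 0` carries everything
  have hzero : ∀ j : ℕ, j ≠ 0 → ∫ x in S j, K x ∂μ' = 0 := fun j hj =>
    setIntegral_shell_addChar_quasiChar_eq_zero μ' hm hc hc1 (by omega) w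
  have hmain : ∫ x in S 0, K x ∂μ' = ((residueFieldCard F : ℂ) ^ (-w)) ^ n *
      ∫ x in {x : Fˣ | normAbs F (x : F) = (residueFieldCard F : ℝ≥0)⁻¹ ^ n},
        ((ψ (x : F) : Circle) : ℂ) * ((η x : ℂˣ) : ℂ) ∂μ' := by
    have hS0 : S 0 = {x : Fˣ | normAbs F (x : F) = (residueFieldCard F : ℝ≥0)⁻¹ ^ n} := by
      simp only [hS, Nat.cast_zero, add_zero]
    rw [hS0, ← integral_const_mul]
    refine setIntegral_congr_fun (measurableSet_normAbs_shell n) fun x hx => ?_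
    rw [Set.mem_setOf_eq] at hx
    rw [hK]
    dsimp only
    rw [normAbs_cpow_eq_of_eq_zpow hx]
    ring
  rw [h1, hsum.unique (hasSum_single 0 hzero), hmain]

/-- **Tate's local functional equation for ramified `χ`: existence of the `ε`-factor**
(Tate 1950, §2.5, the ramified computation "`ρ(c|·|^s) = N(𝔡𝔣)^{s-1/2} ρ₀(c)`", in the
conventions of `TateLocalFactors`; Bushnell–Henniart 2006, §23.5): for `ψ` of conductor exponent
`m` and `χ` of conductor exponent `c ≥ 1`, with the test function `g = 1_{1+𝔭^c}`
(`Z(g, χ, s) = μ'(U^c)`, `ĝ = μ(𝔭^c) ψ 1_{𝔭^{m-c}}`,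
`Z(ĝ, χ⁻¹, 1-s) = μ(𝔭^c) (q⁻¹T⁻¹)^{m-c} G`, `G = ∫_{A_{m-c}} ψ χ⁻¹ d^×x`), one gets
`ε(s, χ, ψ) = e T^{c-m}` with `e = μ(𝔭^c) G q^{c-m} / μ'(U^c)`. [cite: Tate1950, §2.5] -/
theorem hasTateEpsilon_of_hasConductorExp (μ : Measure F) [μ.IsAddHaarMeasure] (μ' : Measure Fˣ)
    [μ'.IsHaarMeasure] {ψ : AddChar F Circle} (hψ : ψ.IsContinuousNontrivial) {m : ℤ}
    (hm : ψ.HasConductorExp m) {χ : QuasiChar F} {c : ℕ} (hc : χ.HasConductorExp c)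
    (hc1 : 1 ≤ c) :
    HasTateEpsilon ψ μ μ' χ
      ((μ.real (primePowBall F (c : ℤ)) : ℂ) *
        (∫ x in {x : Fˣ | normAbs F (x : F) = (residueFieldCard F : ℝ≥0)⁻¹ ^ (m - c)},
          ((ψ (x : F) : Circle) : ℂ) * ((χ⁻¹ x : ℂˣ) : ℂ) ∂μ') *
        (residueFieldCard F : ℂ) ^ ((c : ℤ) - m) / (μ'.real (unitFiltration F c) : ℂ))
      ((c : ℤ) - m) := by
  have hq : residueFieldCard F ≠ 0 := residueFieldCard_ne_zero F
  have hq0 : (residueFieldCard F : ℂ) ≠ 0 := Nat.cast_ne_zero.2 hq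
  set G : ℂ := ∫ x in {x : Fˣ | normAbs F (x : F) = (residueFieldCard F : ℝ≥0)⁻¹ ^ (m - c)},
    ((ψ (x : F) : Circle) : ℂ) * ((χ⁻¹ x : ℂˣ) : ℂ) ∂μ' with hGdef
  set U : ℂ := (μ'.real (unitFiltration F c) : ℂ) with hUdef
  have hU : U ≠ 0 := by
    rw [hUdef]
    exact_mod_cast measureReal_unitFiltration_ne_zero μ' hc1
  set g : F → ℂ := ((1 : F) +ᵥ primePowBall F (c : ℤ)).indicator fun _ => (1 : ℂ) with hgdef
  have hg : g ∈ SchwartzBruhat F := indicator_one_vadd_primePowBall_mem_schwartzBruhat (c : ℤ) 1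
  have hĝ : fourierSB ψ μ g = fun y => (μ.real (primePowBall F (c : ℤ)) : ℂ) *
      (((ψ y : Circle) : ℂ) * (primePowBall F (m - c)).indicator (fun _ => (1 : ℂ)) y) := by
    classical
    ext y
    rw [hgdef, fourierSB_indicator_one_vadd_primePowBall μ hm (c : ℤ) y]
    by_cases hy : y ∈ primePowBall F (m - c)
    · rw [if_pos hy, Set.indicator_of_mem hy, mul_one, mul_comm]
    · rw [if_neg hy, Set.indicator_of_notMem hy, mul_zero, mul_zero]
  -- `L(s, χ) = L(1-s, χ⁻¹) = 1`
  have hL : tateLRat χ = 1 := by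
    rw [tateLRat, tateEulerFactor_of_not_isUnramified (hc.not_isUnramified hc1), map_one, inv_one]
  have hL' : tateLRatDual χ = 1 := by
    rw [tateLRatDual, tateEulerFactor_of_not_isUnramified (hc.inv.not_isUnramified hc1), map_one,
      inv_one]
  rw [HasTateEpsilon, hL, hL', div_one, mul_one]
  refine hasTateGamma_of_test μ μ' hψ hg fun σ hσ s hs1 hs2 => ?_
  set T : ℂ := (residueFieldCard F : ℂ) ^ (-s) with hTdef
  have hT0 : T ≠ 0 := Complex.cpow_ne_zero_iff.2 (Or.inl hq0)
  have hZg : tateZeta μ' g χ s = U := tateZeta_indicator_one_vadd_primePowBall μ' hc1 hc.1 s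
  have hZĝ : tateZeta μ' (fourierSB ψ μ g) χ⁻¹ (1 - s) = (μ.real (primePowBall F (c : ℤ)) : ℂ) *
      (((residueFieldCard F : ℂ) ^ (-(1 - s))) ^ (m - c) * G) := by
    rw [hĝ, tateZeta_const_mul, tateZeta_addChar_mul_indicator_primePowBall μ' hm hc.inv hc1 hσ.inv
      (by rw [Complex.sub_re, Complex.one_re]; linarith)]
  refine ⟨by rw [hZg]; exact hU, ?_⟩
  rw [hZĝ, hZg, evalAtQ_tateEpsilonRat hq, ← hTdef, cpow_neg_one_sub hq s, ← hTdef, mul_zpow,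
    inv_zpow', inv_zpow', neg_sub]
  field_simp

omit [ValuativeRel F] [TopologicalSpace F] [IsNonarchimedeanLocalField F] [BorelSpace F] in
/-- `fourierSB` is linear in scalars: `(a f)^ = a f̂`. [folklore] -/
theorem fourierSB_const_mul (ψ : AddChar F Circle) (μ : Measure F) (a : ℂ) (f : F → ℂ) :
    fourierSB ψ μ (fun x => a * f x) = fun y => a * fourierSB ψ μ f y := by
  ext y
  rw [fourierSB_apply, fourierSB_apply, ← integral_const_mul]
  refine integral_congr_ae (ae_of_all _ fun x => ?_)
  ring

/-- **`Z(1_{-1+𝔭^c}, χ, s) = χ(-1) μ'(U^c)`** for `χ` trivial on `U^c` (`c ≥ 1`): the zeta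
integral of the double Fourier transform of `1_{1+𝔭^c}` (up to scalars), used as in Tate's
Lemma 2.4.3 (1). [folklore] -/
theorem tateZeta_indicator_comp_one_add (μ' : Measure Fˣ) [μ'.IsMulLeftInvariant]
    {χ : QuasiChar F} {c : ℕ} (hc1 : 1 ≤ c) (hχ : ∀ x ∈ unitFiltration F c, χ x = 1) (s : ℂ) :
    tateZeta μ' (fun z => (primePowBall F (c : ℤ)).indicator (fun _ => (1 : ℂ)) (1 + z)) χ s =
      ((χ (-1) : ℂˣ) : ℂ) * (μ'.real (unitFiltration F c) : ℂ) := by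
  haveI : BorelSpace Fˣ := Units.borelSpace
  have hkey : ∀ z : Fˣ, (primePowBall F (c : ℤ)).indicator (fun _ => (1 : ℂ)) (1 + (((-1 : Fˣ) * z : Fˣ) : F)) *
      ((χ ((-1 : Fˣ) * z) : ℂˣ) : ℂ) * (((normAbs F ((((-1 : Fˣ) * z : Fˣ) : F)) : ℝ≥0) : ℝ) : ℂ) ^ s =
        (unitFiltration F c).indicator (fun _ => ((χ (-1) : ℂˣ) : ℂ)) z := by
    intro z
    have hz1 : (1 : F) + (((-1 : Fˣ) * z : Fˣ) : F) = -((z : F) - 1) := by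
      rw [Units.val_mul, Units.val_neg, Units.val_one]
      ring
    by_cases hz : z ∈ unitFiltration F c
    · have hmem : (1 : F) + (((-1 : Fˣ) * z : Fˣ) : F) ∈ primePowBall F (c : ℤ) := by
        rw [hz1]
        exact neg_mem_primePowBall ((mem_unitFiltration_iff_sub_one_mem hc1 z).1 hz)
      rw [Set.indicator_of_mem hmem, Set.indicator_of_mem hz, map_mul, hχ z hz, mul_one,
        Units.val_mul, map_mul, Units.val_neg, Units.val_one, normAbs_neg, map_one, hz.1]
      simp
    · have hmem : (1 : F) + (((-1 : Fˣ) * z : Fˣ) : F) ∉ primePowBall F (c : ℤ) := fun h => hz (by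
        rw [hz1] at h
        have h' := neg_mem_primePowBall h
        rw [neg_neg] at h'
        exact (mem_unitFiltration_iff_sub_one_mem hc1 z).2 h')
      rw [Set.indicator_of_notMem hmem, Set.indicator_of_notMem hz, zero_mul, zero_mul]
  rw [tateZeta, ← integral_mul_left_eq_self _ (-1 : Fˣ)]
  simp_rw [hkey]
  rw [integral_indicator_const _ (measurableSet_unitFiltration hc1), Complex.real_smul, mul_comm]

/-- **The Gauss sum does not vanish** (Tate 1950, §2.5: "`ρ₀(c)` … has absolute value 1";
obtained here as in Tate's Lemma 2.4.3 (1), `ρ(c) ρ(ĉ) = c(-1)`): with `ψ` of conductor exponent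
`m` and `χ` of conductor exponent `c ≥ 1`, `G = ∫_{A_{m-c}} ψ χ⁻¹ d^×x ≠ 0`.  Indeed the
functional equation for `χ⁻¹` (`hasTateEpsilon_of_hasConductorExp`) applied to
`ĝ = μ(𝔭^c) ψ 1_{𝔭^{m-c}}`, whose transform is `μ(𝔭^c) μ(𝔭^{m-c}) 1_{-1+𝔭^c}`, reads
`χ(-1) μ(𝔭^c) μ(𝔭^{m-c}) μ'(U^c) = γ' · μ(𝔭^c) (q⁻¹T⁻¹)^{m-c} G`. [cite: Tate1950, §2.5] -/
theorem gaussSum_shell_ne_zero (μ : Measure F) [μ.IsAddHaarMeasure] (μ' : Measure Fˣ)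
    [μ'.IsHaarMeasure] {ψ : AddChar F Circle} (hψ : ψ.IsContinuousNontrivial) {m : ℤ}
    (hm : ψ.HasConductorExp m) {χ : QuasiChar F} {c : ℕ} (hc : χ.HasConductorExp c)
    (hc1 : 1 ≤ c) :
    ∫ x in {x : Fˣ | normAbs F (x : F) = (residueFieldCard F : ℝ≥0)⁻¹ ^ (m - c)},
      ((ψ (x : F) : Circle) : ℂ) * ((χ⁻¹ x : ℂˣ) : ℂ) ∂μ' ≠ 0 := by
  intro hG
  obtain ⟨σ, hσ⟩ := χ.exists_hasExponent
  have hq : residueFieldCard F ≠ 0 := residueFieldCard_ne_zero F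
  -- the functional equation for `χ⁻¹`, applied to `ĝ` at `s' = 1 - s₀`, `s₀ = 1/2 - σ`
  have hFE := hasTateEpsilon_of_hasConductorExp μ μ' hψ hm hc.inv hc1
  set s₀ : ℂ := ((1 / 2 - σ : ℝ) : ℂ) with hs₀
  have hs₀re : s₀.re = 1 / 2 - σ := by rw [hs₀, Complex.ofReal_re]
  set g : F → ℂ := ((1 : F) +ᵥ primePowBall F (c : ℤ)).indicator fun _ => (1 : ℂ) with hgdef
  have hg : g ∈ SchwartzBruhat F := indicator_one_vadd_primePowBall_mem_schwartzBruhat (c : ℤ) 1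
  have hĝ : fourierSB ψ μ g = fun y => (μ.real (primePowBall F (c : ℤ)) : ℂ) *
      (((ψ y : Circle) : ℂ) * (primePowBall F (m - c)).indicator (fun _ => (1 : ℂ)) y) := by
    classical
    ext y
    rw [hgdef, fourierSB_indicator_one_vadd_primePowBall μ hm (c : ℤ) y]
    by_cases hy : y ∈ primePowBall F (m - c)
    · rw [if_pos hy, Set.indicator_of_mem hy, mul_one, mul_comm]
    · rw [if_neg hy, Set.indicator_of_notMem hy, mul_zero, mul_zero]
  have hĝĝ : fourierSB ψ μ (fourierSB ψ μ g) = fun z => (μ.real (primePowBall F (c : ℤ)) : ℂ) *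
      ((μ.real (primePowBall F (m - c)) : ℂ) *
        (primePowBall F (c : ℤ)).indicator (fun _ => (1 : ℂ)) (1 + z)) := by
    classical
    rw [hĝ, fourierSB_const_mul]
    ext z
    rw [fourierSB_addChar_mul_indicator_primePowBall μ hm (m - c) z, sub_sub_cancel]
    by_cases hz : 1 + z ∈ primePowBall F (c : ℤ)
    · rw [if_pos hz, Set.indicator_of_mem hz, mul_one]
    · rw [if_neg hz, Set.indicator_of_notMem hz, mul_zero, mul_zero, mul_zero]
  have key := hFE (-σ) hσ.inv (fourierSB ψ μ g) (fourierSB_mem_schwartzBruhat μ hψ hg) (1 - s₀)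
    (by rw [Complex.sub_re, Complex.one_re, hs₀re]; linarith)
    (by rw [Complex.sub_re, Complex.one_re, hs₀re]; linarith)
  have hχ : χ⁻¹⁻¹ = χ := inv_inv χ
  rw [hχ, sub_sub_cancel, hĝĝ, tateZeta_const_mul, tateZeta_const_mul,
    tateZeta_indicator_comp_one_add μ' hc1 hc.1, hĝ, tateZeta_const_mul,
    tateZeta_addChar_mul_indicator_primePowBall μ' hm hc.inv hc1 hσ.inv
      (by rw [Complex.sub_re, Complex.one_re, hs₀re]; linarith), hG] at key
  simp only [mul_zero] at key
  have hB1 : (μ.real (primePowBall F (c : ℤ)) : ℂ) ≠ 0 := by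
    exact_mod_cast (ENNReal.toReal_pos (addHaar_primePowBall_pos μ _).ne'
      (measure_primePowBall_lt_top μ _).ne).ne'
  have hB2 : (μ.real (primePowBall F (m - c)) : ℂ) ≠ 0 := by
    exact_mod_cast (ENNReal.toReal_pos (addHaar_primePowBall_pos μ _).ne'
      (measure_primePowBall_lt_top μ _).ne).ne'
  have hU : (μ'.real (unitFiltration F c) : ℂ) ≠ 0 := by
    exact_mod_cast measureReal_unitFiltration_ne_zero μ' hc1
  exact mul_ne_zero hB1 (mul_ne_zero hB2 (mul_ne_zero (χ _).ne_zero hU)) key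

end Ramified


/-! ### Existence and uniqueness of `ε(s, χ, ψ)` and `γ(s, χ, ψ)` -/

section Main

/-- The `L`-ratio `L(1-s, χ⁻¹)/L(s, χ) ∈ ℂ(T)` is non-zero (`P_η(0) = 1` for every `η`).
[folklore] -/
theorem tateLRatDual_div_tateLRat_ne_zero (χ : QuasiChar F) : tateLRatDual χ / tateLRat χ ≠ 0 := by
  have h0 : ∀ η : QuasiChar F, (tateEulerFactor η).eval 0 = 1 := fun η => by
    unfold tateEulerFactor
    split_ifs <;> simp
  have hP : tateEulerFactor χ ≠ 0 := fun h => by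
    have h1 := h0 χ
    rw [h, eval_zero] at h1
    exact zero_ne_one h1
  refine div_ne_zero (inv_ne_zero (aeval_dualVar_ne_zero (by rw [h0]; exact one_ne_zero)))
    (inv_ne_zero ?_)
  exact (map_ne_zero_iff _ (IsFractionRing.injective ℂ[X] (RatFunc ℂ))).2 hP

variable [MeasurableSpace F] [BorelSpace F]

/-- **Existence of Tate's local `ε`-factor** (Tate 1950, Thm. 2.4.1 with the computations of
§2.5; Bushnell–Henniart 2006, §23.4–23.5): for `ψ` continuous non-trivial and Haar measures `μ`,
`μ'`, every quasi-character `χ` admits monomial data `(e, a)`, `e ≠ 0`, with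
`Z(f̂, χ⁻¹, 1-s) = e q^{-as} L(1-s, χ⁻¹)/L(s, χ) Z(f, χ, s)` on the strip — by
`hasTateEpsilon_of_isUnramified` (conductor exponent `0`, with a Mathlib uniformiser normalising
`P_χ`) or `hasTateEpsilon_of_hasConductorExp` and `gaussSum_shell_ne_zero` (conductor exponent
`≥ 1`). [cite: Tate1950, Thm. 2.4.1] -/
theorem exists_hasTateEpsilon (μ : Measure F) [μ.IsAddHaarMeasure] (μ' : Measure Fˣ)
    [μ'.IsHaarMeasure] {ψ : AddChar F Circle} (hψ : ψ.IsContinuousNontrivial) (χ : QuasiChar F) :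
    ∃ e : ℂ, ∃ a : ℤ, e ≠ 0 ∧ HasTateEpsilon ψ μ μ' χ e a := by
  obtain ⟨m, hm⟩ := hψ.exists_hasConductorExp
  obtain ⟨c, hc⟩ := χ.exists_hasConductorExp
  have hBpos : ∀ n : ℤ, (μ.real (primePowBall F n) : ℂ) ≠ 0 := fun n => by
    exact_mod_cast (ENNReal.toReal_pos (addHaar_primePowBall_pos μ n).ne'
      (measure_primePowBall_lt_top μ n).ne).ne'
  rcases Nat.eq_zero_or_pos c with rfl | hc1
  · -- conductor exponent `0`: `χ` is unramified
    have hiff : χ.HasConductorExp 0 ↔ χ.IsUnramified := QuasiChar.hasConductorExp_zero_iff_holds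
    have hχ : χ.IsUnramified := hiff.1 hc
    obtain ⟨ϖ, hϖ⟩ := Valuation.exists_isUniformizer_of_isCyclic_of_nontrivial (valuation F)
    have hnorm : normAbs F (ϖ : F) = (residueFieldCard F : ℝ≥0)⁻¹ := normAbs_uniformizer_holds hϖ
    have hP : tateEulerFactor χ =
        1 - Polynomial.C ((χ (Units.mk0 (ϖ : F) hϖ.ne_zero) : ℂˣ) : ℂ) * X :=
      tateEulerFactor_of_isUnramified_holds hχ hϖ
    have hP' : tateEulerFactor χ⁻¹ =
        1 - Polynomial.C ((χ (Units.mk0 (ϖ : F) hϖ.ne_zero) : ℂˣ) : ℂ)⁻¹ * X := by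
      rw [tateEulerFactor_of_isUnramified_holds hχ.inv hϖ]
      change 1 - Polynomial.C (((χ (Units.mk0 (ϖ : F) hϖ.ne_zero))⁻¹ : ℂˣ) : ℂ) * X = _
      rw [Units.val_inv_eq_inv_val]
    exact ⟨_, -m, mul_ne_zero (hBpos m) (zpow_ne_zero _ (χ _).ne_zero),
      hasTateEpsilon_of_isUnramified μ μ' hψ hm hχ hϖ.ne_zero hnorm hP hP'⟩
  · -- conductor exponent `c ≥ 1`
    refine ⟨_, (c : ℤ) - m, ?_, hasTateEpsilon_of_hasConductorExp μ μ' hψ hm hc hc1⟩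
    refine div_ne_zero (mul_ne_zero (mul_ne_zero (hBpos _)
      (gaussSum_shell_ne_zero μ μ' hψ hm hc hc1))
      (zpow_ne_zero _ (Nat.cast_ne_zero.2 (residueFieldCard_ne_zero F)))) ?_
    exact_mod_cast measureReal_unitFiltration_ne_zero μ' hc1

variable (ψ : AddChar F Circle) (μ : Measure F) (μ' : Measure Fˣ) (χ : QuasiChar F)

/-- **Discharge of the named fact `existsUnique_hasTateEpsilon`** (`TateLocalFactors`; Tate 1950,
§2.5; Bushnell–Henniart 2006, §23.4–23.5): existence is `exists_hasTateEpsilon`; uniqueness of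
the pair `(e, a)`: the `γ`-factor is unique (`HasTateGamma.unique`), the `L`-ratio cancels
(`tateLRatDual_div_tateLRat_ne_zero`), and `e T^a` with `e ≠ 0` determines `(e, a)`
(`tateEpsilonRat_injective`). [cite: Tate1950, Thm. 2.4.1 and §2.5] -/
theorem existsUnique_hasTateEpsilon_holds : existsUnique_hasTateEpsilon ψ μ μ' χ := by
  intro hψ _ _
  obtain ⟨e, a, he, h⟩ := exists_hasTateEpsilon μ μ' hψ χ
  refine ⟨(e, a), h, ?_⟩
  rintro ⟨e', a'⟩ h'
  have hγ : tateEpsilonRat e' a' * tateLRatDual χ / tateLRat χ =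
      tateEpsilonRat e a * tateLRatDual χ / tateLRat χ := HasTateGamma.unique h' h
  rw [mul_div_assoc, mul_div_assoc] at hγ
  have hε := mul_right_cancel₀ (tateLRatDual_div_tateLRat_ne_zero χ) hγ
  obtain ⟨h1, h2⟩ := tateEpsilonRat_injective he hε.symm
  rw [Prod.mk.injEq]
  exact ⟨h1.symm, h2.symm⟩

/-- **Discharge of the named fact `existsUnique_hasTateGamma`** (`TateLocalFactors`; Tate 1950,
Thm. 2.4.1): Tate's `γ`-factor exists (`γ = ε L(1-s, χ⁻¹)/L(s, χ)`) and is unique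
(`HasTateGamma.existsUnique_of_exists`). [cite: Tate1950, Thm. 2.4.1] -/
theorem existsUnique_hasTateGamma_holds : existsUnique_hasTateGamma ψ μ μ' χ := by
  intro hψ _ _
  obtain ⟨e, a, -, h⟩ := exists_hasTateEpsilon μ μ' hψ χ
  exact HasTateGamma.existsUnique_of_exists ⟨_, h⟩

variable {ψ μ μ' χ}

/-- **Discharge of the named fact `hasTateEpsilon_ne_zero`** (`TateLocalFactors`; Tate 1950,
§2.5): the constant `e = ε(0, χ, ψ)` is non-zero
(`hasTateEpsilon_ne_zero_of_existsUnique_hasTateEpsilon`). [cite: Tate1950, §2.5] -/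
theorem hasTateEpsilon_ne_zero_holds :
    hasTateEpsilon_ne_zero (ψ := ψ) (μ := μ) (μ' := μ') (χ := χ) :=
  hasTateEpsilon_ne_zero_of_existsUnique_hasTateEpsilon (existsUnique_hasTateEpsilon_holds ψ μ μ' χ)

/-- **Discharge of the named fact `hasTateEpsilon_exponent`** (`TateLocalFactors`; Tate 1950,
§2.5; Bushnell–Henniart 2006, §23.5 Proposition): if `ψ` has conductor exponent `m` and `χ`
conductor exponent `c`, then `ε(s, χ, ψ) = e q^{-(c-m)s}`, i.e. `a = c - m` — by uniqueness of
`(e, a)` (`existsUnique_hasTateEpsilon_holds`) and the explicit witnesses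
`hasTateEpsilon_of_isUnramified` (`a = -m`, `c = 0`) and `hasTateEpsilon_of_hasConductorExp`
(`a = c - m`). [cite: Tate1950, §2.5] -/
theorem hasTateEpsilon_exponent_holds :
    hasTateEpsilon_exponent (ψ := ψ) (μ := μ) (μ' := μ') (χ := χ) := by
  intro hψ _ _ e a h m c hm hc
  obtain ⟨⟨e₀, a₀⟩, h₀, huniq⟩ := existsUnique_hasTateEpsilon_holds ψ μ μ' χ hψ
  -- an explicit witness with exponent `c - m`
  have hw : ∃ e' : ℂ, HasTateEpsilon ψ μ μ' χ e' ((c : ℤ) - m) := by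
    rcases Nat.eq_zero_or_pos c with rfl | hc1
    · have hiff : χ.HasConductorExp 0 ↔ χ.IsUnramified := QuasiChar.hasConductorExp_zero_iff_holds
      have hχ : χ.IsUnramified := hiff.1 hc
      obtain ⟨ϖ, hϖ⟩ := Valuation.exists_isUniformizer_of_isCyclic_of_nontrivial (valuation F)
      have hnorm : normAbs F (ϖ : F) = (residueFieldCard F : ℝ≥0)⁻¹ := normAbs_uniformizer_holds hϖ
      have hP : tateEulerFactor χ =
          1 - Polynomial.C ((χ (Units.mk0 (ϖ : F) hϖ.ne_zero) : ℂˣ) : ℂ) * X :=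
        tateEulerFactor_of_isUnramified_holds hχ hϖ
      have hP' : tateEulerFactor χ⁻¹ =
          1 - Polynomial.C ((χ (Units.mk0 (ϖ : F) hϖ.ne_zero) : ℂˣ) : ℂ)⁻¹ * X := by
        rw [tateEulerFactor_of_isUnramified_holds hχ.inv hϖ]
        change 1 - Polynomial.C (((χ (Units.mk0 (ϖ : F) hϖ.ne_zero))⁻¹ : ℂˣ) : ℂ) * X = _
        rw [Units.val_inv_eq_inv_val]
      have h := hasTateEpsilon_of_isUnramified μ μ' hψ hm hχ hϖ.ne_zero hnorm hP hP'
      exact ⟨(μ.real (primePowBall F m) : ℂ) *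
        ((χ (Units.mk0 (ϖ : F) hϖ.ne_zero) : ℂˣ) : ℂ) ^ (-m), by rwa [Nat.cast_zero, zero_sub]⟩
    · exact ⟨_, hasTateEpsilon_of_hasConductorExp μ μ' hψ hm hc hc1⟩
  obtain ⟨e', he'⟩ := hw
  have h1 := huniq ⟨e, a⟩ h
  have h2 := huniq ⟨e', (c : ℤ) - m⟩ he'
  have h3 := congrArg Prod.snd (h1.trans h2.symm)
  exact h3

/-- **Discharge of the named fact `hasTateEpsilon_unramified`** (`TateLocalFactors`; Tate 1950,
§2.5, the case "`χ` unramified, `𝔡 = 𝒪`"): for unramified `χ`, `ψ` of conductor exponent `0`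
and `μ(𝒪) = 1`, `ε(s, χ, ψ) = 1` — the case `m = 0` of `hasTateEpsilon_of_isUnramified`
(`e = μ(𝒪) χ(ϖ)⁰ = 1`, `a = 0`). [cite: Tate1950, §2.5] -/
theorem hasTateEpsilon_unramified_holds :
    hasTateEpsilon_unramified (ψ := ψ) (μ := μ) (μ' := μ') (χ := χ) := by
  intro hψ _ _ hχ hm hμ
  obtain ⟨ϖ, hϖ⟩ := Valuation.exists_isUniformizer_of_isCyclic_of_nontrivial (valuation F)
  have hnorm : normAbs F (ϖ : F) = (residueFieldCard F : ℝ≥0)⁻¹ := normAbs_uniformizer_holds hϖ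
  have hP : tateEulerFactor χ =
      1 - Polynomial.C ((χ (Units.mk0 (ϖ : F) hϖ.ne_zero) : ℂˣ) : ℂ) * X :=
    tateEulerFactor_of_isUnramified_holds hχ hϖ
  have hP' : tateEulerFactor χ⁻¹ =
      1 - Polynomial.C ((χ (Units.mk0 (ϖ : F) hϖ.ne_zero) : ℂˣ) : ℂ)⁻¹ * X := by
    rw [tateEulerFactor_of_isUnramified_holds hχ.inv hϖ]
    change 1 - Polynomial.C (((χ (Units.mk0 (ϖ : F) hϖ.ne_zero))⁻¹ : ℂˣ) : ℂ) * X = _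
    rw [Units.val_inv_eq_inv_val]
  have h := hasTateEpsilon_of_isUnramified μ μ' hψ hm hχ hϖ.ne_zero hnorm hP hP'
  rwa [neg_zero, zpow_zero, mul_one, measureReal_def, hμ, ENNReal.toReal_one, Complex.ofReal_one] at h

end Main

end Literature.NumberTheory.Automorphic
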